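import Literature.NumberTheory.EllipticCurves.GrossPointsExistence
import Literature.NumberTheory.EllipticCurves.GrossPointsFinite
import Literature.NumberTheory.EllipticCurves.QuadOrderPicardClassNumberTower
import Literature.NumberTheory.Automorphic.QuadraticOrdersRhoLegendre
import HarnessLib

/-!
# The number of Gross points of conductor `c`: `#H_N(K; c) = 2^t · #Pic(𝒪_c)`
# (Bertolini–Darmon 1996, Lemma 2.5 (1)), and Lemma 2.1 in both directions

Topic `NumberTheory/EllipticCurves`; sequel of `GrossPoints.lean` (the set `grossPoints K S c = H_{N⁺,N⁻}(K; c)`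
of Heegner points of conductor `c` on the definite Shimura set of a Brandt setup `S` of type `(N⁺, N⁻)`),
`GrossPointsExistence.lean` (BD96 Lemma 2.1, existence direction), `GrossPointsPicardActionFree.lean`
(the free `Pic(𝒪_c)`-action, `h(𝒪_c) ∣ #H(c)`) and `GrossPointsFinite.lean` (`H(c)` is finite). THEOREMS, plus
six definitions with bodies used to phrase them (`gammaC`, `OptClass`, `pointOf`, `tC`, `nC`, `grossPointsAction`); no named
fact, no `sorry`, no instance, no notation.

Bertolini–Darmon, *Heegner points on Mumford–Tate curves*, Invent. Math. 126 (1996), §2.3, Lemma 2.5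
(p. 431 of the held copy `paper:doi-10-1007-s002220050105`, PDF p. 19): "Suppose that `N` is a product of
`t` primes. Let `h` denote the cardinality of `Pic(O)` … **Lemma 2.5.** 1. There are exactly `2^t h` Heegner
points of conductor `c` on `X_{N⁺,N⁻}`, if `(N⁺, N⁻)` is the factorization satisfying the Heegner condition
of Sect. 2.2. … *Proof (sketch).* … it can be shown (cf. [Vi], or [Gr2]) that the group `Pic(O) × W` acts
simply transitively on the set `H_N(K; c)`". And §2.2, Lemma 2.1 (p. 430, PDF p. 18): "suppose that `c` is
prime to `N`. Then the set `H_{M⁺,M⁻}(K; c)` is non-empty if and only if `(M⁺, M⁻) = (N⁺, N⁻)`. *Sketch of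
proof.* Suppose that `H_{M⁺,M⁻}(K; c)` is non-empty. A Heegner point … gives rise to an orientation
`O → 𝔽_l` (with `l` dividing `M⁺`) and `O → 𝔽_{l²}` (with `l` dividing `M⁻`). It follows that all `l`
dividing `M⁺` are split in `K/ℚ`, and that all `l` dividing `M⁻` are inert".

## What is proved, and how

We follow the reference "[Vi]" of both printed sketches: Eichler's theory of optimal embeddings as
formalised in the tree (`Automorphic/EichlerEmbeddingLocalGlobal.lean`: Vignéras, LNM 800, III §5
Thm. 5.11, `Brandt.card_throughClass_optimalOrder_eq`: the number `E(B)` of classes modulo `ℚ(γ)ˣ` of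
invertible right `O`-ideals `J` with `O_L(J) ∩ ℚ(γ) = B` is `h(B) · ∏_{p ∈ S₀} m_p(B)`), rather than the
Atkin–Lehner group `W` (not in the tree).

* §0–§1 **The bridge** (`natCard_grossPoints_eq_natCard_optClass`): fix ONE embedding `f : K → D` and
  `γ_c = c f(ω)` (`𝓞_K = ℤ[ω]`, so `f(𝒪_c) = ℤ[γ_c]`, `gammaC`). Every Gross point is `[(f, J)]` for this
  `f` (all embeddings are conjugate, Skolem–Noether `exists_unitConj_comp_eq`, and
  `[(b f b⁻¹, I)] = [(f, b⁻¹ I)]`), `(f, J)` is a Heegner representative of conductor `c` iff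
  `O_L(J) ∩ f(K) = f(𝒪_c)` (`isHeegner_iff`), and `[(f, J)] = [(f, J')]` iff `J' = b J` with `b`
  centralising `f(K)` (`pointOf_injective`): `H(c) ≃ E(f(𝒪_c))` (`bijective_pointOf`).
* §2 `f(𝒪_c) = [1, γ_c]` is an order of `f(K)` through `γ_c` (`isQuadOrder_ordLat`) with
  `γ_c² = t_c γ_c − n_c`, `(t_c, n_c) = (c t, −c² m)` for `ω² = m + t ω`, discriminant
  `t_c² − 4 n_c = c² d_K` (`tC_sq_sub_four_mul_nC`); its idelic class number is `h(c² d_K)`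
  (`classNumber_ordLat_eq`, tree `Brandt.PicHyp.classNumber_eq` = Cox Thm. 7.7 (ii)), which is `#Pic(𝒪_c)`
  (tree `QuadOrderTower.natCard_classGroup_quadOrder_eq_classNumber`, Cox Thm. 7.24).
* §3 **`#H(c) = h(f(𝒪_c)) · ∏_{q ∣ N⁺N⁻} m_q(f(𝒪_c))`** for EVERY `c ≥ 1` and every Brandt setup
  (`natCard_grossPoints_eq_classNumber_mul_prod`): Vignéras III.5.11 with exceptional set
  `S₀ = {q ∣ N⁺N⁻} ∪ S₁`, the local numbers at `q ∤ N⁺N⁻` being `1` (level-`0` matrix model,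
  `Brandt.localEmbeddingNumber_eq_one_of_model`).
* §4 **The local numbers at `q ∣ N`, `q ∤ c d_K`** from the tree's `RamHyp`/`LevelHyp` counts
  (`EichlerEmbeddingLocalRamified/Level.lean`): `m_q = 1 − (d_K/q)` at `q ∣ N⁻` and `m_q = 1 + (d_K/q)`
  at `q ∥ N⁺` (`localEmbeddingNumber_eq_of_dvd_nminus/nplus`), through the root count
  `ρ_q(t_c, n_c) = ρ_q(t, −m) = 1 + (d_K/q)` (`rho_tC_nC_eq_ite`; Legendre symbol for odd `q`, `χ₈` at
  `q = 2`, tree `QuadraticOrdersRhoLegendre` + `KroneckerSplitting`) written as "`2` if `q` splits in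
  `K`, `0` otherwise"; `𝒪_c` is maximal at such `q` (`not_exists_nonmax`). Also: a rational prime has
  one or two primes of `𝓞 K` above it (`ncard_primesOver_eq_one_or_eq_two`).
* §5 **Lemma 2.5 (1)**: `natCard_grossPoints_eq_two_pow_mul_classNumber` (`#H(c) = 2^t · h(c² d_K)`,
  any universe) and `natCard_grossPoints_eq_two_pow_mul_natCard_classGroup` (`= 2^t · #Pic(𝒪_c)`,
  `K : Type`), `t = #{q prime : q ∣ N⁺N⁻}`; and **Lemma 2.5 (2) for `p ∤ N`** (`u = 1`):
  `#H(cp^{k+1}) = 2^t (p − (d_K/p)) p^k #Pic(𝒪_c)` (`natCard_grossPoints_mul_prime_pow`, through the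
  tree's class-number tower `QuadOrderTower.natCard_classGroup_eq_of_prime_not_dvd_pow_succ`).
* §6 **Lemma 2.1, "only if"** (`split_and_inert_of_nonempty_grossPoints`): `H(c) ≠ ∅`, finite, so
  `h · ∏ m_q > 0` and every `m_q ≠ 0`, forcing `q ∣ N⁺` split and `q ∣ N⁻` inert; with the tree's
  existence direction, `nonempty_grossPoints_iff`.
* §7 **The `Pic(𝒪_c)`-orbits** (`grossPointsAction`, the sub-action of `Pic(𝒪_c)` on `H(c)`):
  `#H(c) = #(orbits) · #Pic(𝒪_c)` (free action, tree `GrossPointsPicardActionFree`) and hence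
  **exactly `2^t` orbits** (`natCard_orbits_grossPoints_eq_two_pow`) — the orbit structure behind the
  printed proof ("the orbits of Heegner points under the action of `Pic(O)` correspond exactly to sets
  of Heegner points with a given orientation"; the orientations / Atkin–Lehner group `W` themselves are
  not formalised).
* §8 **Conductor `1`**: `#H_N(K; 1) = 2^t · h_K` with `h_K = NumberField.classNumber K`
  (`natCard_grossPoints_one_eq_two_pow_mul_classNumber`, any universe; `h(d_K) = h_K` is the tree's
  `Quadratic.card_reducedForms_eq_classNumber`).
* §9 **Lemma 2.5 (2) at `c = 1` with the unit index** (`u = ½ #𝒪_Kˣ`, every imaginary quadratic `K`,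
  `p ∤ N`, `n ≥ 1`): `#H_N(K; pⁿ) · #𝒪_Kˣ = 2^t · 2 h_K · p^{n−1} (p − (d_K/p))`
  (`natCard_grossPoints_prime_pow_mul_card_units`, `K : Type`; the tree's Cox 7.24
  `RingClass.card_ringClassGroup_mul_card_units_of_two_le` through `Pic(𝒪_{pⁿ}) ≃ I_K(pⁿ)/P_{K,ℤ}(pⁿ)`).

## Faithfulness notes

* Hypotheses of §5–§6 are those printed: `N = N⁺N⁻` square-free (`S.squarefree` only gives `N⁻`),
  `(N, d_K) = 1`, `(c, N) = 1`; BD96's blanket "for simplicity `c` prime to `N·Disc(K)`" of §2.3 is NOT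
  needed for (1) (the local numbers at `q ∣ c` never enter: `q ∤ N`). The factor `u = ½ #𝒪ˣ` of
  Lemma 2.5 (2) enters only (2); our version of (2) is the case `u = 1` (`2 ≤ c ∨ d_K < −4`) and `p ∤ N`
  (for `p ∣ N⁻` the curve changes, BD96 §2.2 `(N⁺_*, N⁻_*)`; not treated).
* "Inert" is `#{𝔮 ∣ ℓ} = 1` as in the tree's Heegner hypotheses (`GrossPointsExistence`,
  `HeegnerPoints.lean`); under `(ℓ, d_K) = 1` this excludes ramification.
* §3 holds with no hypothesis on `c`, `N`, `d_K` beyond `c ≥ 1` and `[K : ℚ] = 2`; it is the statement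
  to specialise for conductors not prime to the level.

## References

* [BertoliniDarmon1996] M. Bertolini, H. Darmon, *Heegner points on Mumford–Tate curves*, Invent. Math.
  126 (1996) 413–456, §2.2 Lemma 2.1 (p. 430), §2.3 Lemma 2.5 (p. 431).
* [VignerasLNM800] M.-F. Vignéras, *Arithmétique des algèbres de quaternions*, LNM 800 (1980), Ch. I §2
  Thm. 2.1 (Skolem–Noether), Ch. II §3 (local embedding numbers `m_p = 1 ∓ (L/p)`), Ch. III §5 Thm. 5.11,
  Cor. 5.12, Exercice 5.2.
* [Gross1987] B. H. Gross, *Heights and the special values of L-series*, CMS Conf. Proc. 7 (1987), §3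
  (BD96's "[Gr2]").
* [Cox2013] D. A. Cox, *Primes of the form x² + ny²*, 2nd ed. (2013), §7.A Lemma 7.2, §7.B Thm. 7.7,
  §7.D Prop. 7.20, Thm. 7.24.
-/

noncomputable section

open scoped Pointwise
open NumberField Module IsDedekindDomain
open Literature.NumberTheory.QuadraticFields.Quadratic
open Literature.NumberTheory.Automorphic

universe u

namespace Literature.NumberTheory.EllipticCurves

namespace GrossPointsCount

open GrossPointTowerExistence GrossPointsExistence

variable {K : Type u} [Field K] [NumberField K]

/-! ### §0 Coordinates in the quadratic field and the element `γ_c = c · f(ω)` -/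

section Coordinates

/-- `ω ∉ ℚ` for a `ℤ`-basis `(1, ω)` of `𝓞 K` (linear independence of `b 0 = 1`, `b 1 = ω`). [folklore] -/
private theorem ratCast_ne_basis_one (b : Basis (Fin 2) ℤ (𝓞 K)) (hb : b 0 = 1) (r : ℚ) :
    (r : K) ≠ ((b 1 : 𝓞 K) : K) := by
  intro h
  have h1 : (r : K) * ((r.den : ℤ) : K) = ((r.num : ℤ) : K) := by
    have e := Rat.mul_den_eq_num r
    rw [Int.cast_natCast, ← Rat.cast_natCast, ← Rat.cast_mul, e, Rat.cast_intCast]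
  have hK : ((r.den : ℤ) : K) * ((b 1 : 𝓞 K) : K) = ((r.num : ℤ) : K) := by
    rw [← h, mul_comm]; exact h1
  have hO : (r.den : ℤ) • b 1 = (r.num : ℤ) • b 0 := by
    apply RingOfIntegers.ext
    rw [hb, zsmul_eq_mul, zsmul_eq_mul, mul_one]
    simp only [map_mul, map_intCast]
    exact hK
  have hd : (r.den : ℤ) ≠ 0 := by exact_mod_cast r.den_ne_zero
  have hli := b.linearIndependent
  rw [Fintype.linearIndependent_iff] at hli
  have h0 := hli ![-(r.num : ℤ), (r.den : ℤ)] (by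
    rw [Fin.sum_univ_two]
    simp only [Matrix.cons_val_zero, Matrix.cons_val_one]
    rw [hO, neg_smul, neg_add_cancel]) 1
  simp only [Matrix.cons_val_one] at h0
  exact hd h0

/-- `ω ∉ ℚ` as a statement about the bottom subalgebra. [folklore] -/
private theorem basis_one_not_mem_bot (b : Basis (Fin 2) ℤ (𝓞 K)) (hb : b 0 = 1) :
    ((b 1 : 𝓞 K) : K) ∉ (⊥ : Subalgebra ℚ K) := by
  rw [Algebra.mem_bot]
  rintro ⟨r, hr⟩
  exact ratCast_ne_basis_one b hb r hr

/-- `c ω ∉ ℚ` for `c ≠ 0`. [folklore] -/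
private theorem natCast_mul_basis_one_not_mem_bot (b : Basis (Fin 2) ℤ (𝓞 K)) (hb : b 0 = 1) {c : ℕ}
    (hc : c ≠ 0) : (c : K) * ((b 1 : 𝓞 K) : K) ∉ (⊥ : Subalgebra ℚ K) := by
  intro h
  apply basis_one_not_mem_bot b hb
  have hcK : (c : K) ≠ 0 := Nat.cast_ne_zero.mpr hc
  have e : ((b 1 : 𝓞 K) : K) = (c : K)⁻¹ * ((c : K) * ((b 1 : 𝓞 K) : K)) := by
    rw [← mul_assoc, inv_mul_cancel₀ hcK, one_mul]
  rw [e]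
  refine Subalgebra.mul_mem _ ?_ h
  have : (c : K)⁻¹ = algebraMap ℚ K ((c : ℚ)⁻¹) := by simp
  rw [this]
  exact Subalgebra.algebraMap_mem _ _

/-- `K = ℚ + ℚ u` for `u ∉ ℚ` in the quadratic field `K`. [folklore] -/
private theorem exists_ratCoords (h2 : finrank ℚ K = 2) {u : K} (hu : u ∉ (⊥ : Subalgebra ℚ K)) (z : K) :
    ∃ p q : ℚ, z = algebraMap ℚ K p + q • u := by
  have htop : finrank ℚ (⊤ : Subalgebra ℚ K) ≤ 2 := by
    rw [(Subalgebra.topEquiv (R := ℚ) (A := K)).toLinearEquiv.finrank_eq, h2]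
  exact Subalgebra.exists_eq_add_smul_of_finrank_le_two ⊤ htop Algebra.mem_top Algebra.mem_top hu

/-- The image of `u ∉ ℚ` under an embedding `f : K → D` is not in `ℚ`. [folklore] -/
private theorem apply_not_mem_bot {D : Type*} [Ring D] [Algebra ℚ D] [Nontrivial D] (f : K →ₐ[ℚ] D)
    {u : K} (hu : u ∉ (⊥ : Subalgebra ℚ K)) : f u ∉ (⊥ : Subalgebra ℚ D) := by
  intro h
  obtain ⟨q, hq⟩ := Algebra.mem_bot.mp h
  have hq' : algebraMap ℚ K q = u := by
    apply f.toRingHom.injective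
    change f (algebraMap ℚ K q) = f u
    rw [f.commutes q]
    exact hq
  exact hu (hq' ▸ Algebra.mem_bot.mpr ⟨q, rfl⟩)

/-- **`ℚ[f(u)] = f(K)`** for `u ∉ ℚ` in the quadratic field `K`: `y ∈ ℚ[f u] ↔ y = f x` for some
`x`. [folklore] -/
private theorem mem_adjoin_apply_iff (h2 : finrank ℚ K = 2) {D : Type*} [Ring D] [Algebra ℚ D]
    (f : K →ₐ[ℚ] D) {u : K} (hu : u ∉ (⊥ : Subalgebra ℚ K)) {y : D} :
    y ∈ Algebra.adjoin ℚ {f u} ↔ ∃ x : K, f x = y := by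
  constructor
  · intro hy
    have hle : Algebra.adjoin ℚ {f u} ≤ f.range :=
      Algebra.adjoin_le (Set.singleton_subset_iff.mpr ⟨u, rfl⟩)
    have hy' : y ∈ f.range := hle hy
    rwa [_root_.AlgHom.mem_range] at hy'
  · rintro ⟨x, rfl⟩
    obtain ⟨p, q, rfl⟩ := exists_ratCoords h2 hu x
    rw [map_add, map_smul, f.commutes]
    exact Brandt.ratCoords_mem_adjoin _ _ _

/-- Two embeddings `K → D` that agree at some `u ∉ ℚ` are equal. [folklore] -/
private theorem algHom_ext_of_apply_eq (h2 : finrank ℚ K = 2) {D : Type*} [Ring D] [Algebra ℚ D]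
    {f g : K →ₐ[ℚ] D} {u : K} (hu : u ∉ (⊥ : Subalgebra ℚ K)) (hfg : f u = g u) : f = g := by
  apply AlgHom.ext
  intro z
  obtain ⟨p, q, rfl⟩ := exists_ratCoords h2 hu z
  rw [map_add, map_add, map_smul, map_smul, f.commutes, g.commutes, hfg]

/-- A unit commuting with `f u` (`u ∉ ℚ`) commutes with all of `f(K)`, so conjugation by it fixes
`f`: `(b f b⁻¹) = f`. [folklore] -/
private theorem unitConj_comp_eq_self_of_commute (h2 : finrank ℚ K = 2) {D : Type*} [Ring D] [Algebra ℚ D]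
    (f : K →ₐ[ℚ] D) {u : K} (hu : u ∉ (⊥ : Subalgebra ℚ K)) {b : Dˣ}
    (hb : (b : D) * f u = f u * b) : (unitConj b).comp f = f := by
  refine algHom_ext_of_apply_eq h2 hu ?_
  rw [AlgHom.comp_apply, unitConj_apply, hb, mul_assoc, Units.mul_inv, mul_one]

/-- Conversely, if conjugation by `b` fixes `f` then `b` commutes with every `f x`. [folklore] -/
private theorem commute_of_unitConj_comp_eq_self {D : Type*} [Ring D] [Algebra ℚ D] (f : K →ₐ[ℚ] D)
    {b : Dˣ} (hb : (unitConj b).comp f = f) (x : K) : (b : D) * f x = f x * b := by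
  have h := DFunLike.congr_fun hb x
  rw [AlgHom.comp_apply, unitConj_apply] at h
  calc (b : D) * f x = ((b : D) * f x * ↑b⁻¹) * b := by rw [Units.inv_mul_cancel_right]
    _ = f x * b := by rw [h]

end Coordinates

/-! ### §1 Gross points of conductor `c` ↔ classes of ideals with optimal order `f(𝒪_c)` -/

section Bridge

variable {Nplus Nminus : ℕ} (S : Brandt.XiSetup Nplus Nminus)

/-- The algebra of a Brandt setup is a division algebra (it is totally definite). [folklore] -/
private theorem forall_isUnit : ∀ x : S.D, x ≠ 0 → IsUnit x := fun _ hx =>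
  isUnit_of_isTotallyDefinite S.D S.isTotallyDefinite hx

/-- The optimal order only depends on the subalgebra `ℚ[γ]`: `O_L(J) ∩ ℚ[c γ] = O_L(J) ∩ ℚ[γ]` for a
non-zero rational `c`. [folklore] -/
private theorem adjoin_smul_eq {D : Type*} [Ring D] [Algebra ℚ D] (γ : D) {c : ℚ} (hc : c ≠ 0) :
    Algebra.adjoin ℚ {c • γ} = Algebra.adjoin ℚ {γ} := by
  apply le_antisymm
  · exact Algebra.adjoin_le (Set.singleton_subset_iff.mpr
      (Subalgebra.smul_mem _ (Algebra.self_mem_adjoin_singleton ℚ γ) c))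
  · refine Algebra.adjoin_le (Set.singleton_subset_iff.mpr ?_)
    have h : c⁻¹ • (c • γ) ∈ Algebra.adjoin ℚ {c • γ} :=
      Subalgebra.smul_mem (Algebra.adjoin ℚ {c • γ}) (Algebra.self_mem_adjoin_singleton ℚ (c • γ)) c⁻¹
    rwa [smul_smul, inv_mul_cancel₀ hc, one_smul] at h

/-- `optimalOrder J (c • γ) = optimalOrder J γ` for `c ≠ 0`. [folklore] -/
private theorem optimalOrder_smul_eq {D : Type*} [Ring D] [Algebra ℚ D] (J : Submodule ℤ D) (γ : D)
    {c : ℚ} (hc : c ≠ 0) : Brandt.optimalOrder J (c • γ) = Brandt.optimalOrder J γ := by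
  ext y
  rw [Brandt.mem_optimalOrder_iff, Brandt.mem_optimalOrder_iff, adjoin_smul_eq γ hc]

variable (h2 : finrank ℚ K = 2) (b : Basis (Fin 2) ℤ (𝓞 K)) (hb : b 0 = 1) (f : K →ₐ[ℚ] S.D)

/-- **The element `γ_c = c · f(ω)`** through which the order `f(𝒪_c) = ℤ + ℤ γ_c` passes. [folklore] -/
def gammaC (b : Basis (Fin 2) ℤ (𝓞 K)) (f : K →ₐ[ℚ] S.D) (c : ℕ) : S.D :=
  (c : ℚ) • f ((b 1 : 𝓞 K) : K)

/-- `γ_c = f(c ω)` (`𝒪_c = [1, c ω]`). [cite: Cox2013, §7.A Lemma 7.2] -/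
theorem gammaC_eq_apply (c : ℕ) : gammaC S b f c = f ((c : K) * ((b 1 : 𝓞 K) : K)) := by
  rw [gammaC, map_mul, map_natCast, Algebra.smul_def, map_natCast]

include hb in
/-- `γ_c ∉ ℚ` for `c ≠ 0` (`[1, c ω]` has rank `2`). [cite: Cox2013, §7.A Lemma 7.2] -/
theorem gammaC_not_mem_bot {c : ℕ} (hc : c ≠ 0) : gammaC S b f c ∉ (⊥ : Subalgebra ℚ S.D) := by
  haveI : Nontrivial S.D := Brandt.nontrivial_of_isQuaternionAlgebra
  rw [gammaC_eq_apply]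
  exact apply_not_mem_bot f (natCast_mul_basis_one_not_mem_bot b hb hc)

include h2 hb in
/-- `y ∈ ℚ[γ_c] ↔ y ∈ f(K)` (`ℚ(γ_c) = f(K)` is the commutative subfield `K(h)` of Vignéras). [cite: VignerasLNM800, Ch. I §1] -/
theorem mem_adjoin_gammaC_iff {c : ℕ} (hc : c ≠ 0) {y : S.D} :
    y ∈ Algebra.adjoin ℚ {gammaC S b f c} ↔ ∃ x : K, f x = y := by
  rw [gammaC_eq_apply]
  exact mem_adjoin_apply_iff h2 f (natCast_mul_basis_one_not_mem_bot b hb hc)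

/-- `optimalOrder J γ_c = optimalOrder J f(ω)`: the optimal order `O_L(J) ∩ L` depends only on the subfield `L = ℚ(γ_c) = ℚ(f ω)`. [cite: VignerasLNM800, Ch. III §5 Thm. 5.11] -/
theorem optimalOrder_gammaC {c : ℕ} (hc : c ≠ 0) (J : Submodule ℤ S.D) :
    Brandt.optimalOrder J (gammaC S b f c) = Brandt.optimalOrder J (f ((b 1 : 𝓞 K) : K)) :=
  optimalOrder_smul_eq J _ (Nat.cast_ne_zero.mpr hc)

include h2 hb in
/-- **Heegner representatives `(f, J)` of conductor `c` are exactly the invertible right ideals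
`J` with optimal order `O_L(J) ∩ f(K) = f(𝒪_c)`.** [cite: BertoliniDarmon1996, §2.1] -/
theorem isHeegner_iff {c : ℕ} (hc : c ≠ 0) (J : Submodule ℤ S.D) :
    (⟨f, J⟩ : GrossRep S.D K).IsHeegner S.O c ↔
      J ∈ Brandt.rightIdeals S.O ∧ Brandt.optimalOrder J (gammaC S b f c) = ordLat f c := by
  constructor
  · rintro ⟨hJ, hopt⟩
    refine ⟨hJ, le_antisymm ?_ ?_⟩
    · intro y hy
      obtain ⟨hyL, hyA⟩ := Brandt.mem_optimalOrder_iff.mp hy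
      obtain ⟨x, rfl⟩ := (mem_adjoin_gammaC_iff S h2 b hb f hc).mp hyA
      exact GrossRep.apply_mem_embLattice f ((hopt x).mp hyL)
    · intro y hy
      obtain ⟨a, ha, rfl⟩ := GrossRep.mem_embLattice_iff.mp hy
      exact Brandt.mem_optimalOrder_iff.mpr
        ⟨(hopt a).mpr ha, (mem_adjoin_gammaC_iff S h2 b hb f hc).mpr ⟨a, rfl⟩⟩
  · rintro ⟨hJ, hopt⟩
    haveI : Nontrivial S.D := Brandt.nontrivial_of_isQuaternionAlgebra
    haveI : IsAddTorsionFree S.D := S.isAddTorsionFree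
    have hJinv : IsInvertibleRightIdeal S.O J :=
      isInvertibleRightIdeal_of_mem_rightIdeals hJ
    rw [optimalOrder_gammaC S b f hc] at hopt
    exact isHeegner_of_optimalOrder_eq S h2 b hb f hJinv hopt


/-! #### The comparison map `[J] ↦ [(f, J)]` -/

include h2 hb in
/-- The reduced trace and norm of `f(c ω)`, for any embedding `f`, are those of `c ω`. [folklore] -/
private theorem reducedTrace_reducedNorm_gammaC_eq (f' : K →ₐ[ℚ] S.D) (c : ℕ) (hc : c ≠ 0) :
    reducedTrace ℚ S.D (gammaC S b f' c) = reducedTrace ℚ S.D (gammaC S b f c) ∧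
      reducedNorm ℚ S.D (gammaC S b f' c) = reducedNorm ℚ S.D (gammaC S b f c) := by
  have hu := natCast_mul_basis_one_not_mem_bot b hb hc
  obtain ⟨p, q, hpq⟩ := exists_ratCoords h2 hu ((c : K) * ((b 1 : 𝓞 K) : K) * ((c : K) * ((b 1 : 𝓞 K) : K)))
  obtain ⟨h1, h1'⟩ := GrossSpace.reducedTrace_reducedNorm_apply_eq S f hu hpq
  obtain ⟨h2', h2''⟩ := GrossSpace.reducedTrace_reducedNorm_apply_eq S f' hu hpq
  rw [gammaC_eq_apply, gammaC_eq_apply, h1, h1', h2', h2'']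
  exact ⟨rfl, rfl⟩

include h2 hb in
/-- **Skolem–Noether for embeddings of the quadratic field**: any two embeddings `f, f' : K → D`
into the algebra of a Brandt setup are conjugate, `f' = b f b⁻¹`. [cite: VignerasLNM800, Ch. I §2 Thm. 2.1] -/
theorem exists_unitConj_comp_eq (f' : K →ₐ[ℚ] S.D) : ∃ bb : S.Dˣ, (unitConj bb).comp f = f' := by
  haveI : Nontrivial S.D := Brandt.nontrivial_of_isQuaternionAlgebra
  have hD := forall_isUnit S
  have hu := natCast_mul_basis_one_not_mem_bot b hb one_ne_zero
  have hγ : gammaC S b f 1 ≠ 0 := fun h => gammaC_not_mem_bot S b hb f one_ne_zero (h ▸ Subalgebra.zero_mem _)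
  have hγ' : gammaC S b f' 1 ≠ 0 := fun h => gammaC_not_mem_bot S b hb f' one_ne_zero (h ▸ Subalgebra.zero_mem _)
  obtain ⟨htr, hnr⟩ := reducedTrace_reducedNorm_gammaC_eq S h2 b hb f f' 1 one_ne_zero
  obtain ⟨x, hx⟩ := exists_units_conj_eq_of_reducedTrace_eq_of_reducedNorm_eq ℚ S.D hD
    (γ := (hD _ hγ').unit) (γ' := (hD _ hγ).unit)
    (by rw [IsUnit.unit_spec]; exact gammaC_not_mem_bot S b hb f' one_ne_zero)
    (by rw [IsUnit.unit_spec, IsUnit.unit_spec]; exact htr)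
    (by rw [IsUnit.unit_spec, IsUnit.unit_spec]; exact hnr)
  refine ⟨x, algHom_ext_of_apply_eq h2 hu ?_⟩
  have hx' := congrArg (fun y : S.Dˣ => (y : S.D)) hx
  simp only [Units.val_mul, IsUnit.unit_spec] at hx'
  rw [gammaC_eq_apply, gammaC_eq_apply] at hx'
  rw [AlgHom.comp_apply, unitConj_apply]
  exact hx'

/-- The **set of classes** (modulo `f(K)ˣ`) of invertible right `O`-ideals `J` with optimal order
`O_L(J) ∩ f(K) = f(𝒪_c)` — the global embedding classes `E(f(𝒪_c))` counted by Eichler's trace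
formula (tree `Brandt.card_throughClass_optimalOrder_eq`). [cite: VignerasLNM800, Ch. III §5 Thm. 5.11] -/
abbrev OptClass (b : Basis (Fin 2) ℤ (𝓞 K)) (f : K →ₐ[ℚ] S.D) (c : ℕ) : Type :=
  {q : Brandt.ThroughClass S.O (gammaC S b f c) //
    Brandt.optimalOrder q.rep (gammaC S b f c) = ordLat f c}

/-- The Gross point `[(f, J)]` of a class `[J]`, through the chosen representative `J = q.rep`. [cite: BertoliniDarmon1996, §2.1] -/
def pointOf {c : ℕ} (q : OptClass S b f c) : GrossSpace S.D K := GrossSpace.mk ⟨f, q.1.rep⟩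

include h2 hb in
/-- `[(f, q.rep)]` is a Gross point of conductor `c`. [cite: BertoliniDarmon1996, §2.1] -/
theorem pointOf_mem {c : ℕ} (hc : c ≠ 0) (q : OptClass S b f c) : pointOf S b f q ∈ grossPoints K S c :=
  mk_mem_grossPoints_iff.mpr ((isHeegner_iff S h2 b hb f hc _).mpr ⟨q.1.rep_mem.1, q.2⟩)

include h2 hb in
/-- `[(f, c' J)] = [(f, J)]` for a unit `c'` commuting with `γ_c` (it centralises `f(K)`). [folklore] -/
private theorem mk_smul_eq_mk {c : ℕ} (hc : c ≠ 0) {c' : S.Dˣ}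
    (hc' : (c' : S.D) * gammaC S b f c = gammaC S b f c * c') (J : Submodule ℤ S.D) :
    GrossSpace.mk (⟨f, c' • J⟩ : GrossRep S.D K) = GrossSpace.mk ⟨f, J⟩ := by
  have hu := natCast_mul_basis_one_not_mem_bot b hb hc
  rw [gammaC_eq_apply] at hc'
  have hf : (unitConj c').comp f = f := unitConj_comp_eq_self_of_commute h2 f hu hc'
  have e : c' • (⟨f, J⟩ : GrossRep S.D K) = ⟨f, c' • J⟩ := by
    ext : 1
    · exact hf
    · rfl
  rw [← e, GrossSpace.mk_units_smul]

/-- **Injectivity**: `[(f, J)] = [(f, J')]` forces `J' = b J` with `b` centralising `f(K)`. [cite: VignerasLNM800, Ch. III §5 Thm. 5.11 (proof)] -/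
theorem pointOf_injective {c : ℕ} : Function.Injective (pointOf S b f (c := c)) := by
  intro q q' hqq
  obtain ⟨bb, hbb⟩ := GrossSpace.mk_eq_mk_iff.mp hqq
  have hemb : (unitConj bb).comp f = f := congrArg GrossRep.emb hbb
  have hlat : bb • q'.1.rep = q.1.rep := congrArg GrossRep.lat hbb
  have hcomm : (bb : S.D) * gammaC S b f c = gammaC S b f c * bb := by
    rw [gammaC_eq_apply]; exact commute_of_unitConj_comp_eq_self f hemb _
  apply Subtype.ext
  rw [← Brandt.ThroughClass.mk_rep q.1, ← Brandt.ThroughClass.mk_rep q'.1, eq_comm]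
  exact Brandt.ThroughClass.mk_eq_mk_iff.mpr ⟨bb, hcomm, hlat.symm⟩

include h2 hb in
/-- **Surjectivity**: every Gross point of conductor `c` is `[(f, J)]` for the FIXED embedding `f`
(all embeddings are conjugate, and `[(b f b⁻¹, I)] = [(f, b⁻¹ I)]`). [cite: VignerasLNM800, Ch. III §5 Thm. 5.11 (proof); Ch. I §2 Thm. 2.1] -/
theorem exists_pointOf_eq {c : ℕ} (hc : c ≠ 0) {x : GrossSpace S.D K} (hx : x ∈ grossPoints K S c) :
    ∃ q : OptClass S b f c, pointOf S b f q = x := by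
  have hD := forall_isUnit S
  obtain ⟨r, rfl, hr⟩ := hx
  obtain ⟨bb, hbb⟩ := exists_unitConj_comp_eq S h2 b hb f r.emb
  -- `r = bb • (f, bb⁻¹ I)`
  set r₀ : GrossRep S.D K := ⟨f, bb⁻¹ • r.lat⟩ with hr₀
  have hsmul : bb • r₀ = r := by
    ext : 1
    · exact hbb
    · change bb • bb⁻¹ • r.lat = r.lat
      rw [smul_inv_smul]
  have hr₀H : r₀.IsHeegner S.O c := by
    rw [← GrossRep.IsHeegner.units_smul_iff S c bb r₀, hsmul]; exact hr
  obtain ⟨hJ₀, hopt⟩ := (isHeegner_iff S h2 b hb f hc _).mp hr₀H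
  have hthrough : bb⁻¹ • r.lat ∈ Brandt.idealsThrough S.O (gammaC S b f c) := by
    refine ⟨hJ₀, Brandt.optimalOrder_le_leftOrder _ (gammaC S b f c) ?_⟩
    rw [hopt, gammaC_eq_apply]
    exact GrossRep.apply_mem_embLattice f (natCast_mul_mem_quadOrder c (b 1))
  refine ⟨⟨Brandt.ThroughClass.mk ⟨_, hthrough⟩, ?_⟩, ?_⟩
  · rw [Brandt.ThroughClass.optimalOrder_rep_mk hD (gammaC_not_mem_bot S b hb f hc)]
    exact hopt
  · obtain ⟨c', hc', hrep⟩ := Brandt.ThroughClass.exists_rep_mk_eq (⟨_, hthrough⟩ : Brandt.idealsThrough S.O _)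
    change GrossSpace.mk ⟨f, (Brandt.ThroughClass.mk ⟨_, hthrough⟩).rep⟩ = GrossSpace.mk r
    rw [hrep]
    change GrossSpace.mk ⟨f, c' • r₀.lat⟩ = GrossSpace.mk r
    rw [mk_smul_eq_mk S h2 b hb f hc hc']
    change GrossSpace.mk r₀ = GrossSpace.mk r
    rw [← hsmul, GrossSpace.mk_units_smul]

include h2 hb in
/-- **The comparison bijection** `E(f(𝒪_c)) ≃ H(c)`: classes modulo `f(K)ˣ` of invertible right
`O`-ideals with optimal order `f(𝒪_c)` correspond to the Gross points of conductor `c`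
(Vignéras III.5.11, proof (2): optimal embeddings modulo units ↔ `G_A \ T_A / L^•`). [cite: VignerasLNM800, Ch. III §5 Thm. 5.11 (proof)] [cite: BertoliniDarmon1996, §2.1] -/
theorem bijective_pointOf {c : ℕ} (hc : c ≠ 0) :
    Function.Bijective (fun q : OptClass S b f c => (⟨pointOf S b f q, pointOf_mem S h2 b hb f hc q⟩ : grossPoints K S c)) := by
  refine ⟨fun q q' h => pointOf_injective S b f (congrArg Subtype.val h), fun y => ?_⟩
  obtain ⟨q, hq⟩ := exists_pointOf_eq S h2 b hb f hc y.2
  exact ⟨q, Subtype.ext hq⟩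

include h2 hb in
/-- **`#H(c) = E(f(𝒪_c))`**: the number of Gross points of conductor `c ≥ 1` is the number of classes
modulo `f(K)ˣ` of invertible right `O`-ideals `J` with `O_L(J) ∩ f(K) = f(𝒪_c)`. [cite: VignerasLNM800, Ch. III §5 Thm. 5.11 (proof)] [cite: BertoliniDarmon1996, §2.1] -/
theorem natCard_grossPoints_eq_natCard_optClass {c : ℕ} (hc : c ≠ 0) :
    Nat.card (grossPoints K S c) = Nat.card (OptClass S b f c) :=
  (Nat.card_congr (Equiv.ofBijective _ (bijective_pointOf S h2 b hb f hc))).symm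

end Bridge

/-! ### §2 The order `f(𝒪_c) = ℤ[γ_c]`: basis, trace, norm, discriminant `c² d_K` -/

section Order

variable {Nplus Nminus : ℕ} (S : Brandt.XiSetup Nplus Nminus)
variable (h2 : finrank ℚ K = 2) (b : Basis (Fin 2) ℤ (𝓞 K)) (hb : b 0 = 1) (f : K →ₐ[ℚ] S.D)

/-- The trace `t_c = c t` of `γ_c = c ω` (`ω² = m + t ω`). [folklore] -/
def tC (b : Basis (Fin 2) ℤ (𝓞 K)) (c : ℕ) : ℤ := (c : ℤ) * b.repr (b 1 * b 1) 1

/-- The norm `n_c = -c² m` of `γ_c = c ω` (`ω² = m + t ω`). [folklore] -/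
def nC (b : Basis (Fin 2) ℤ (𝓞 K)) (c : ℕ) : ℤ := -((c : ℤ) ^ 2 * b.repr (b 1 * b 1) 0)

include hb in
/-- **`t_c² - 4 n_c = c² d_K`**: the discriminant of `𝒪_c`. [cite: Cox2013, §7.A (7.3)] -/
theorem tC_sq_sub_four_mul_nC (c : ℕ) : tC b c ^ 2 - 4 * nC b c = (c : ℤ) ^ 2 * NumberField.discr K := by
  rw [discr_eq_sq_add_four_mul b hb, tC, nC]; ring

include hb in
/-- `(c ω)² = c² m + (c t) (c ω)` in `K`. [folklore] -/
private theorem natCast_mul_basis_one_mul_self (c : ℕ) :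
    (c : K) * ((b 1 : 𝓞 K) : K) * ((c : K) * ((b 1 : 𝓞 K) : K)) =
      algebraMap ℚ K (((-(nC b c) : ℤ) : ℚ)) + ((tC b c : ℤ) : ℚ) • ((c : K) * ((b 1 : 𝓞 K) : K)) := by
  have hωω : ((b 1 : 𝓞 K) : K) * ((b 1 : 𝓞 K) : K) =
      ((b.repr (b 1 * b 1) 0 : ℤ) : K) + ((b.repr (b 1 * b 1) 1 : ℤ) : K) * ((b 1 : 𝓞 K) : K) := by
    have h := congrArg (fun z : 𝓞 K => (z : K)) (basis_one_mul_self_eq b hb)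
    simpa using h
  rw [nC, tC, neg_neg, Algebra.smul_def]
  simp only [Int.cast_mul, Int.cast_pow, Int.cast_natCast, map_intCast, map_mul, map_pow, map_natCast]
  have e : (c : K) * ((b 1 : 𝓞 K) : K) * ((c : K) * ((b 1 : 𝓞 K) : K)) =
      (c : K) ^ 2 * (((b 1 : 𝓞 K) : K) * ((b 1 : 𝓞 K) : K)) := by ring
  rw [e, hωω]
  ring

include hb in
/-- **`γ_c² = t_c γ_c - n_c`** (the minimal equation of `c ω`). [cite: Cox2013, §7.A Lemma 7.2 and (7.2)] -/
theorem gammaC_mul_self (c : ℕ) :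
    gammaC S b f c * gammaC S b f c = ((tC b c : ℤ) : ℚ) • gammaC S b f c - algebraMap ℚ S.D ((nC b c : ℤ) : ℚ) := by
  rw [gammaC_eq_apply, ← map_mul, natCast_mul_basis_one_mul_self b hb c, map_add, map_smul, f.commutes,
    Int.cast_neg, map_neg, sub_eq_add_neg, add_comm]

include hb in
/-- **`trd γ_c = t_c` and `nrd γ_c = n_c`.** [cite: VignerasLNM800, Ch. I §1] -/
theorem reducedTrace_gammaC_and_reducedNorm_gammaC {c : ℕ} (hc : c ≠ 0) :
    reducedTrace ℚ S.D (gammaC S b f c) = ((tC b c : ℤ) : ℚ) ∧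
      reducedNorm ℚ S.D (gammaC S b f c) = ((nC b c : ℤ) : ℚ) := by
  have hu := natCast_mul_basis_one_not_mem_bot b hb hc
  obtain ⟨h1, h1'⟩ := GrossSpace.reducedTrace_reducedNorm_apply_eq S f hu (natCast_mul_basis_one_mul_self b hb c)
  rw [gammaC_eq_apply, h1, h1', Int.cast_neg, neg_neg]
  exact ⟨rfl, rfl⟩

include hb in
/-- Membership in `f(𝒪_c) = ℤ + ℤ γ_c`. [cite: Cox2013, §7.A Lemma 7.2] -/
theorem mem_ordLat_iff_gammaC (c : ℕ) (y : S.D) :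
    y ∈ ordLat f c ↔ ∃ u v : ℤ, y = algebraMap ℚ S.D u + v • gammaC S b f c :=
  mem_ordLat_iff b hb f c y

include h2 hb in
/-- **`f(𝒪_c)` is an order of `ℚ(γ_c) = f(K)` through `γ_c`** (`c ≥ 1`). [cite: VignerasLNM800, Ch. III §5 Cor. 5.14] -/
theorem isQuadOrder_ordLat {c : ℕ} (hc : c ≠ 0) : Brandt.IsQuadOrder (gammaC S b f c) (ordLat f c) where
  one_mem := GrossRep.mem_embLattice_iff.mpr ⟨1, Subalgebra.one_mem _, map_one f⟩
  mul_mem := by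
    intro x hx y hy
    obtain ⟨a, ha, rfl⟩ := GrossRep.mem_embLattice_iff.mp hx
    obtain ⟨a', ha', rfl⟩ := GrossRep.mem_embLattice_iff.mp hy
    exact GrossRep.mem_embLattice_iff.mpr ⟨a * a', Subalgebra.mul_mem _ ha ha', map_mul f a a'⟩
  gen_mem := by
    rw [gammaC_eq_apply]
    exact GrossRep.apply_mem_embLattice f (natCast_mul_mem_quadOrder c (b 1))
  le_adjoin := by
    intro y hy
    obtain ⟨a, -, rfl⟩ := GrossRep.mem_embLattice_iff.mp hy
    exact (mem_adjoin_gammaC_iff S h2 b hb f hc).mpr ⟨a, rfl⟩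
  fg := by
    have h : ordLat f c = Submodule.span ℤ {(1 : S.D), gammaC S b f c} := by
      apply le_antisymm
      · intro y hy
        obtain ⟨u, v, rfl⟩ := (mem_ordLat_iff_gammaC S b hb f c y).mp hy
        rw [Algebra.algebraMap_eq_smul_one, Int.cast_smul_eq_zsmul]
        exact Submodule.add_mem _ (Submodule.smul_mem _ _ (Submodule.subset_span (by simp)))
          (Submodule.smul_mem _ _ (Submodule.subset_span (by simp)))
      · rw [Submodule.span_le]
        rintro y hy
        simp only [Set.mem_insert_iff, Set.mem_singleton_iff] at hy
        rcases hy with rfl | rfl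
        · exact GrossRep.mem_embLattice_iff.mpr ⟨1, Subalgebra.one_mem _, map_one f⟩
        · rw [gammaC_eq_apply]
          exact GrossRep.apply_mem_embLattice f (natCast_mul_mem_quadOrder c (b 1))
    rw [h]
    exact Submodule.fg_span (Set.toFinite _)
  full := by
    intro z hz
    obtain ⟨x, rfl⟩ := (mem_adjoin_gammaC_iff S h2 b hb f hc).mp (Brandt.mem_adjoinLattice_iff.mp hz)
    obtain ⟨u, v, rfl⟩ := exists_ratCoords h2 (natCast_mul_basis_one_not_mem_bot b hb hc) x
    refine ⟨(u.den * v.den : ℕ), by exact_mod_cast (mul_ne_zero u.den_ne_zero v.den_ne_zero), ?_⟩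
    refine (mem_ordLat_iff_gammaC S b hb f c _).mpr ⟨u.num * v.den, v.num * u.den, ?_⟩
    have hu : ((u.den * v.den : ℕ) : ℚ) * u = (u.num * v.den : ℤ) := by
      push_cast
      rw [mul_comm (u.den : ℚ), mul_assoc, Rat.den_mul_eq_num]
      ring
    have hv : ((u.den * v.den : ℕ) : ℚ) * v = (v.num * u.den : ℤ) := by
      push_cast
      rw [mul_assoc, Rat.den_mul_eq_num]
      ring
    rw [gammaC_eq_apply, ← Int.cast_smul_eq_zsmul ℚ, ← Int.cast_smul_eq_zsmul ℚ (v.num * u.den), ← map_smul,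
      smul_add, Algebra.smul_def, ← map_mul, smul_smul, Int.cast_natCast, hu, hv, map_add, f.commutes,
      map_smul]

include h2 hb in
/-- **`h(f(𝒪_c)) = h(c² d_K)`**: the idelic class number of the order `f(𝒪_c)` (tree
`Brandt.classNumber`) is the number of classes of primitive positive-definite forms of discriminant
`c² d_K` (`K` imaginary quadratic; Cox Thm. 7.7 (ii) through the tree's `Brandt.PicHyp.classNumber_eq`). [cite: Cox2013, §7.B Thm. 7.7, §7.D Thm. 7.24] -/
theorem classNumber_ordLat_eq (hK : IsImaginaryQuadratic K) {c : ℕ} (hc : c ≠ 0) :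
    Brandt.classNumber (gammaC S b f c) (ordLat f c) = BinQF.classNumber ((c : ℤ) ^ 2 * NumberField.discr K) := by
  obtain ⟨htr, hnr⟩ := reducedTrace_gammaC_and_reducedNorm_gammaC S b hb f hc
  have H : Brandt.PicHyp (gammaC S b f c) (ordLat f c) (gammaC S b f c) 0 1 (tC b c) (nC b c) :=
    { hdiv := forall_isUnit S
      hγ := gammaC_not_mem_bot S b hb f hc
      himag := by
        rw [htr, hnr]
        have hd : (tC b c : ℚ) ^ 2 - 4 * (nC b c : ℚ) = ((c : ℤ) : ℚ) ^ 2 * (NumberField.discr K : ℚ) := by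
          exact_mod_cast tC_sq_sub_four_mul_nC b hb c
        have hneg : (NumberField.discr K : ℚ) < 0 := by exact_mod_cast hK.discr_neg
        have hcpos : (0 : ℚ) < ((c : ℤ) : ℚ) ^ 2 := by positivity
        nlinarith
      hB := isQuadOrder_ordLat S h2 b hb f hc
      hm := one_ne_zero
      hσ := by simp
      hBσ := mem_ordLat_iff_gammaC S b hb f c
      hsq := gammaC_mul_self S b hb f c }
  rw [H.classNumber_eq, tC_sq_sub_four_mul_nC b hb c]

end Order

/-! ### §3 Eichler's count: `#H(c) = h(f(𝒪_c)) · ∏_{q ∣ N} m_q(f(𝒪_c))` -/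

section Count

variable {Nplus Nminus : ℕ} (S : Brandt.XiSetup Nplus Nminus)
variable (h2 : finrank ℚ K = 2) (b : Basis (Fin 2) ℤ (𝓞 K)) (hb : b 0 = 1) (f : K →ₐ[ℚ] S.D)

include h2 hb in
/-- **Eichler's trace formula for the optimal embeddings of `𝒪_c`** (Vignéras III.5.11 for the order
`B = f(𝒪_c)` of `f(K)` and the Eichler order `O` of the Brandt setup): the number of classes modulo
`f(K)ˣ` of invertible right `O`-ideals `J` with `O_L(J) ∩ f(K) = f(𝒪_c)` is
`h(f(𝒪_c)) · ∏_{q ∣ N⁺N⁻} m_q(f(𝒪_c))` — the local embedding numbers at the primes `q ∤ N⁺N⁻` are `1`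
(level-`0` matrix model, tree `Brandt.localEmbeddingNumber_eq_one_of_model`). [cite: VignerasLNM800, Ch. III §5 Thm. 5.11; Ch. II §3 Thm. 3.2] -/
theorem natCard_optClass_eq {c : ℕ} (hc : c ≠ 0) :
    Nat.card (OptClass S b f c) =
      Brandt.classNumber (gammaC S b f c) (ordLat f c) *
        ∏ q ∈ (Nplus * Nminus).primeFactors,
          Brandt.localEmbeddingNumber S.O (gammaC S b f c) (ordLat f c) q := by
  classical
  have hO := S.isEichlerOrder.isOrder
  have hB := isQuadOrder_ordLat S h2 b hb f hc
  have hγ := gammaC_not_mem_bot S b hb f hc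
  have hD := forall_isUnit S
  have hN0 : Nplus * Nminus ≠ 0 := mul_ne_zero S.nplus_ne_zero S.squarefree.ne_zero
  obtain ⟨S₁, hS₁, hS₁'⟩ := Brandt.exists_finset_optimalOrder_localAt_eq hO hB (O := S.O)
  set S₀ : Finset ℕ := (Nplus * Nminus).primeFactors ∪ S₁ with hS₀
  have hS₀p : ∀ q ∈ S₀, q.Prime := by
    intro q hq
    rcases Finset.mem_union.mp hq with h | h
    · exact Nat.prime_of_mem_primeFactors h
    · exact hS₁ q h
  have h0 : ∀ q : ℕ, q.Prime → q ∉ S₀ →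
      Brandt.optimalOrder (localAt q S.O) (gammaC S b f c) = localAt q (ordLat f c) :=
    fun q hq hqS => hS₁' q hq fun h => hqS (Finset.mem_union_right _ h)
  have hndvd : ∀ q : ℕ, q.Prime → q ∉ S₀ → ¬ q ∣ Nplus * Nminus := fun q hq hqS hd =>
    hqS (Finset.mem_union_left _ (Nat.mem_primeFactors.mpr ⟨hq, hd, hN0⟩))
  have h1 : ∀ q : ℕ, q.Prime → q ∉ S₀ → ∀ L ∈ Brandt.localIdeals S.O (gammaC S b f c) (ordLat f c) q,
      ∃ c' : S.Dˣ, (c' : S.D) * gammaC S b f c = gammaC S b f c * c' ∧ L = c' • localAt q S.O := by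
    intro q hq hqS L hL
    haveI := Fact.mk hq
    obtain ⟨Φ, hΦ⟩ := S.exists_localAt_iff_integral S.nplus_ne_zero (hndvd q hq hqS)
    exact Brandt.exists_eq_smul_localAt_of_model Φ hD hγ hΦ hO.one_mem hO.mul_mem (h0 q hq hqS) hL
  rw [OptClass, Brandt.card_throughClass_optimalOrder_eq S.isTotallyDefinite hO hγ hB S₀ hS₀p h0 h1]
  -- the primes of `S₁` off `N` contribute `1`
  have hsplit : S₀ = (Nplus * Nminus).primeFactors ∪ (S₁ \ (Nplus * Nminus).primeFactors) := by
    rw [hS₀, Finset.union_sdiff_self_eq_union]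
  have hone : ∀ q ∈ S₁ \ (Nplus * Nminus).primeFactors,
      Brandt.localEmbeddingNumber S.O (gammaC S b f c) (ordLat f c) q = 1 := by
    intro q hq
    rw [Finset.mem_sdiff] at hq
    have hqp : q.Prime := hS₁ q hq.1
    haveI := Fact.mk hqp
    have hnd : ¬ q ∣ Nplus * Nminus := fun hd => hq.2 (Nat.mem_primeFactors.mpr ⟨hqp, hd, hN0⟩)
    obtain ⟨Φ, hΦ⟩ := S.exists_localAt_iff_integral S.nplus_ne_zero hnd
    exact Brandt.localEmbeddingNumber_eq_one_of_model Φ hD hγ hΦ hO.one_mem hO.mul_mem hB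
  rw [hsplit, Finset.prod_union Finset.disjoint_sdiff, Finset.prod_eq_one hone, mul_one]

include h2 hb in
/-- **`#H(c) = h(f(𝒪_c)) · ∏_{q ∣ N⁺N⁻} m_q(f(𝒪_c))`** for every Brandt setup `S` of type `(N⁺, N⁻)`,
every quadratic `K` with an embedding `f : K → D` and every `c ≥ 1` (no hypothesis on `c`, `N`, `d_K`):
the number of Gross points of conductor `c` is Eichler's global embedding number of `𝒪_c`. [cite: VignerasLNM800, Ch. III §5 Thm. 5.11] [cite: BertoliniDarmon1996, §2.3 Lemma 2.5 (proof: "cf. [Vi], or [Gr2]")] -/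
theorem natCard_grossPoints_eq_classNumber_mul_prod {c : ℕ} (hc : c ≠ 0) :
    Nat.card (grossPoints K S c) =
      Brandt.classNumber (gammaC S b f c) (ordLat f c) *
        ∏ q ∈ (Nplus * Nminus).primeFactors,
          Brandt.localEmbeddingNumber S.O (gammaC S b f c) (ordLat f c) q := by
  rw [natCard_grossPoints_eq_natCard_optClass S h2 b hb f hc, natCard_optClass_eq S h2 b hb f hc]

end Count

/-! ### §4 Splitting of `q` in `K` and the root count `ρ_q`; the local numbers at `q ∣ N` -/

section Splitting

open Polynomial UniqueFactorizationMonoid in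
/-- **A prime has one or two primes of `𝓞 K` above it** (`K` quadratic; Cox Prop. 5.16: `p𝓞_K` is
`𝔭²`, `𝔭𝔭'` or prime): Dedekind–Kummer (tree `ncard_primesOver_eq_card_toFinset`) and the factorisation of
`X² − tX − m` modulo `p`. [cite: Cox2013, §5.C Prop. 5.16] -/
theorem ncard_primesOver_eq_one_or_eq_two (h2 : finrank ℚ K = 2) {p : ℕ} (hp : p.Prime) :
    ((Ideal.span {(p : ℤ)}).primesOver (𝓞 K)).ncard = 1 ∨
      ((Ideal.span {(p : ℤ)}).primesOver (𝓞 K)).ncard = 2 := by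
  classical
  obtain ⟨b, hb⟩ := exists_basis_zero_eq_one h2
  haveI := Fact.mk hp
  rw [ncard_primesOver_eq_card_toFinset b hb]
  generalize b.repr (b 1 * b 1) 1 = t
  generalize b.repr (b 1 * b 1) 0 = m
  by_cases hp2 : p = 2
  · subst hp2
    have h20 : (2 : ZMod 2) = 0 := rfl
    have heven : ∀ k : ℤ, ((2 * k : ℤ) : ZMod 2) = 0 := fun k => by
      rw [Int.cast_mul, Int.cast_ofNat, h20, zero_mul]
    have hodd : ∀ k : ℤ, ((2 * k + 1 : ℤ) : ZMod 2) = 1 := fun k => by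
      rw [Int.cast_add, Int.cast_mul, Int.cast_ofNat, h20, zero_mul, zero_add, Int.cast_one]
    obtain ⟨k, rfl | rfl⟩ := Int.even_or_odd' t <;> obtain ⟨j, rfl | rfl⟩ := Int.even_or_odd' m
    · left; rw [heven, heven, card_toFinset_normalizedFactors_X_sq_sub_zero_zero]
    · left; rw [heven, hodd, card_toFinset_normalizedFactors_X_sq_sub_zero_one_zmod_two]
    · right; rw [hodd, heven, card_toFinset_normalizedFactors_X_sq_sub_one_zero]
    · left; rw [hodd, hodd, card_toFinset_normalizedFactors_X_sq_sub_one_one_zmod_two]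
  · haveI : NeZero (2 : ZMod p) := ⟨two_ne_zero_zmod hp2⟩
    by_cases h0 : ((t : ℤ) : ZMod p) ^ 2 + 4 * ((m : ℤ) : ZMod p) = 0
    · left; exact card_toFinset_normalizedFactors_X_sq_sub_of_eq_zero h0
    · by_cases hsq : IsSquare (((t : ℤ) : ZMod p) ^ 2 + 4 * ((m : ℤ) : ZMod p))
      · obtain ⟨r, hr⟩ := hsq
        right
        refine card_toFinset_normalizedFactors_X_sq_sub_of_sq_eq (s := r) (by rw [hr, sq]) ?_
        rintro rfl
        exact h0 (by rw [hr, mul_zero])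
      · left; exact card_toFinset_normalizedFactors_X_sq_sub_of_not_isSquare hsq

/-- **Not split means exactly one prime above**: for `K` quadratic, `ncard = 1 ↔ ncard ≠ 2`. [cite: Cox2013, §5.C Prop. 5.16] -/
theorem ncard_primesOver_eq_one_iff_ne_two (h2 : finrank ℚ K = 2) {p : ℕ} (hp : p.Prime) :
    ((Ideal.span {(p : ℤ)}).primesOver (𝓞 K)).ncard = 1 ↔
      ((Ideal.span {(p : ℤ)}).primesOver (𝓞 K)).ncard ≠ 2 := by
  rcases ncard_primesOver_eq_one_or_eq_two h2 hp with h | h <;> simp [h]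

variable (b : Basis (Fin 2) ℤ (𝓞 K)) (hb : b 0 = 1)

include hb in
/-- **The root count `ρ_q` of `X² − tX − m` (`ω² = m + tω`) detects the splitting of `q ∤ d_K`**:
`ρ_q = 1 + (d_K/q)` is `2` if `q` splits in `K` and `0` otherwise (Kronecker symbol at `2` included). [cite: Cox2013, §5.C Prop. 5.16 and the Kronecker symbol `(D/2)` before it; §7.D Prop. 7.20] -/
theorem rho_eq_ite (h2 : finrank ℚ K = 2) {q : ℕ} (hq : q.Prime) (hqd : ¬ (q : ℤ) ∣ NumberField.discr K) :
    Brandt.rho q (b.repr (b 1 * b 1) 1) (-(b.repr (b 1 * b 1) 0)) =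
      if ((Ideal.span {(q : ℤ)}).primesOver (𝓞 K)).ncard = 2 then 2 else 0 := by
  have hdisc : b.repr (b 1 * b 1) 1 ^ 2 - 4 * (-(b.repr (b 1 * b 1) 0)) = NumberField.discr K := by
    rw [discr_eq_sq_add_four_mul b hb]; ring
  by_cases hq2 : q = 2
  · subst hq2
    simp only [Nat.cast_ofNat] at hqd ⊢
    have h := Brandt.rho_two_eq_one_add_χ₈' (b.repr (b 1 * b 1) 1) (-(b.repr (b 1 * b 1) 0))
    rw [hdisc, ZMod.χ₈_int_eq_if_mod_eight] at h
    have hodd : NumberField.discr K % 2 = 1 := Int.two_dvd_ne_zero.mp hqd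
    have h4 := discr_emod_four h2
    have hsplit := ncard_primesOver_two_eq_two_iff (K := K) h2
    by_cases h8 : NumberField.discr K % 8 = 1
    · rw [if_pos (hsplit.mpr h8)]
      rw [if_neg (by omega), if_pos (Or.inl h8)] at h
      have h' : (Brandt.rho 2 (b.repr (b 1 * b 1) 1) (-(b.repr (b 1 * b 1) 0)) : ℤ) = 2 := by
        rw [h]; norm_num
      exact_mod_cast h'
    · rw [if_neg (fun hh => h8 (hsplit.mp hh))]
      rw [if_neg (by omega), if_neg (by omega)] at h
      have h' : (Brandt.rho 2 (b.repr (b 1 * b 1) 1) (-(b.repr (b 1 * b 1) 0)) : ℤ) = 0 := by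
        rw [h]; norm_num
      exact_mod_cast h'
  · haveI := Fact.mk hq
    have h := Brandt.rho_eq_one_add_legendreSym hq2 (b.repr (b 1 * b 1) 1) (-(b.repr (b 1 * b 1) 0))
    rw [hdisc] at h
    have hd0 : ((NumberField.discr K : ℤ) : ZMod q) ≠ 0 := fun h0 =>
      hqd ((ZMod.intCast_zmod_eq_zero_iff_dvd _ q).mp h0)
    have hsplit := ncard_primesOver_eq_two_iff_legendreSym (K := K) h2 hq2
    by_cases h1 : legendreSym q (NumberField.discr K) = 1
    · rw [if_pos (hsplit.mpr h1)]
      have h' : (Brandt.rho q (b.repr (b 1 * b 1) 1) (-(b.repr (b 1 * b 1) 0)) : ℤ) = 2 := by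
        rw [h, h1]; norm_num
      exact_mod_cast h'
    · rw [if_neg (fun hh => h1 (hsplit.mp hh))]
      have h' : (Brandt.rho q (b.repr (b 1 * b 1) 1) (-(b.repr (b 1 * b 1) 0)) : ℤ) = 0 := by
        rw [h, (legendreSym.eq_neg_one_iff_not_one q hd0).mpr h1]; norm_num
      exact_mod_cast h'

omit [NumberField K] in
/-- **`ρ_q(t_c, n_c) = ρ_q(t, -m)` for `q ∤ c`**: the conductor is invisible at primes not dividing it
(`(t_c, n_c) = (c t, c² (−m))`, scale by the unit `c` mod `q`). [cite: Cox2013, §7.D Prop. 7.20] -/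
theorem rho_tC_nC_eq {q : ℕ} (hq : q.Prime) {c : ℕ} (hqc : ¬ q ∣ c) :
    Brandt.rho q (tC b c) (nC b c) = Brandt.rho q (b.repr (b 1 * b 1) 1) (-(b.repr (b 1 * b 1) 0)) := by
  haveI : NeZero q := ⟨hq.ne_zero⟩
  have hunit : IsUnit (((c : ℤ)) : ZMod q) := by
    rw [Int.cast_natCast, ZMod.isUnit_iff_coprime]
    exact Nat.Coprime.symm ((Nat.Prime.coprime_iff_not_dvd hq).mpr hqc)
  have e : nC b c = (c : ℤ) ^ 2 * (-(b.repr (b 1 * b 1) 0)) := by rw [nC]; ring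
  rw [tC, e]
  exact Brandt.rho_scale _ _ hunit

include hb in
/-- **`ρ_q(t_c, n_c)` is `2` if `q` splits in `K` and `0` otherwise**, for `q ∤ c d_K`. [cite: Cox2013, §7.D Prop. 7.20] -/
theorem rho_tC_nC_eq_ite (h2 : finrank ℚ K = 2) {q : ℕ} (hq : q.Prime) {c : ℕ} (hqc : ¬ q ∣ c)
    (hqd : ¬ (q : ℤ) ∣ NumberField.discr K) :
    Brandt.rho q (tC b c) (nC b c) =
      if ((Ideal.span {(q : ℤ)}).primesOver (𝓞 K)).ncard = 2 then 2 else 0 := by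
  rw [rho_tC_nC_eq b hq hqc, rho_eq_ite b hb h2 hq hqd]

include hb in
/-- **`𝒪_c` is maximal at every `q ∤ c d_K`**: there is no `k` with `q ∣ t_c + 2k`, `q² ∣ k² + t_c k + n_c`
(else `q ∣ (t_c + 2k)² − 4(k² + t_c k + n_c) = c² d_K`). [cite: Cox2013, §7.A Lemma 7.2, §7.C Prop. 7.20] -/
theorem not_exists_nonmax {q : ℕ} (hq : q.Prime) {c : ℕ} (hqc : ¬ q ∣ c)
    (hqd : ¬ (q : ℤ) ∣ NumberField.discr K) :
    ¬ ∃ k : ℤ, (q : ℤ) ∣ tC b c + 2 * k ∧ (q : ℤ) ^ 2 ∣ k ^ 2 + tC b c * k + nC b c := by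
  rintro ⟨k, h1, h2'⟩
  have hid : (tC b c + 2 * k) ^ 2 - 4 * (k ^ 2 + tC b c * k + nC b c) = (c : ℤ) ^ 2 * NumberField.discr K := by
    rw [← tC_sq_sub_four_mul_nC b hb c]; ring
  have hdvd : (q : ℤ) ∣ (c : ℤ) ^ 2 * NumberField.discr K := by
    rw [← hid]
    exact dvd_sub (dvd_pow h1 two_ne_zero)
      (dvd_mul_of_dvd_right ((dvd_pow_self (q : ℤ) two_ne_zero).trans h2') 4)
  have hqZ : Prime (q : ℤ) := Nat.prime_iff_prime_int.mp hq
  rcases hqZ.dvd_or_dvd hdvd with h | h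
  · exact hqc (Int.natCast_dvd_natCast.mp (hqZ.dvd_of_dvd_pow h))
  · exact hqd h

end Splitting

section LocalNumbers

variable {Nplus Nminus : ℕ} (S : Brandt.XiSetup Nplus Nminus)
variable (h2 : finrank ℚ K = 2) (b : Basis (Fin 2) ℤ (𝓞 K)) (hb : b 0 = 1) (f : K →ₐ[ℚ] S.D)

include h2 hb in
/-- The tree's `RamHyp` for `B = f(𝒪_c)` at a prime `q ∣ N⁻` (ramified in `D`; `O` maximal at `q`). [cite: VignerasLNM800, Ch. II §3] -/
theorem ramHyp {c : ℕ} (hc : c ≠ 0) {q : ℕ} [Fact q.Prime] (hqm : q ∣ Nminus) :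
    Brandt.RamHyp q S.O (gammaC S b f c) (ordLat f c) (gammaC S b f c) 0 1 (tC b c) (nC b c) :=
  { hdivp := S.toEichlerPackage.forall_isUnit_scalarExtension_padic hqm
    hOZ := S.toEichlerPackage.isEichlerOrder.isZOrder
    hOp := S.toEichlerPackage.maximalAtP hqm
    hγ := gammaC_not_mem_bot S b hb f hc
    hB := isQuadOrder_ordLat S h2 b hb f hc
    hm := one_ne_zero
    hσ₀ := by simp
    hBσ := mem_ordLat_iff_gammaC S b hb f c
    hsq := gammaC_mul_self S b hb f c }

include h2 hb in
/-- The tree's `LevelHyp` for `B = f(𝒪_c)` at a prime `q ∥ N⁺` (Eichler order of level `q`). [cite: VignerasLNM800, Ch. II §3; Ch. III §5 Prop. 5.1] -/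
theorem exists_levelHyp {c : ℕ} (hc : c ≠ 0) (hsqf : Squarefree Nplus) {q : ℕ} [Fact q.Prime]
    (hqN : q ∣ Nplus) (hqm : ¬ q ∣ Nminus) :
    ∃ Φ : S.D →ₐ[ℚ] Matrix (Fin 2) (Fin 2) ℚ_[q],
      Brandt.LevelHyp Φ S.O (gammaC S b f c) (ordLat f c) (gammaC S b f c) 0 1 (tC b c) (nC b c) := by
  obtain ⟨Φ, hΦ⟩ := exists_levelModel S hsqf hqN hqm
  exact ⟨Φ,
    { hD := forall_isUnit S
      hγ := gammaC_not_mem_bot S b hb f hc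
      hO := hΦ
      hO1 := S.isEichlerOrder.isOrder.one_mem
      hOmul := S.isEichlerOrder.isOrder.mul_mem
      hB := isQuadOrder_ordLat S h2 b hb f hc
      hm := one_ne_zero
      hσ₀ := by simp
      hBσ := mem_ordLat_iff_gammaC S b hb f c
      hsq := gammaC_mul_self S b hb f c }⟩

include h2 hb in
/-- **The local embedding number of `𝒪_c` at a prime `q ∣ N⁻` with `q ∤ c d_K`**: `m_q = 1 − (d_K/q)`, i.e.
`0` if `q` splits in `K` and `2` if `q` is inert (Eichler; Vignéras `m_p = 1 − (L/p)` at `p ∣ D`). [cite: VignerasLNM800, Ch. II §3; Ch. III §5 Thm. 5.11, Exercice 5.2] -/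
theorem localEmbeddingNumber_eq_of_dvd_nminus {c : ℕ} (hc : c ≠ 0) {q : ℕ} (hq : q.Prime)
    (hqm : q ∣ Nminus) (hqc : ¬ q ∣ c) (hqd : ¬ (q : ℤ) ∣ NumberField.discr K) :
    Brandt.localEmbeddingNumber S.O (gammaC S b f c) (ordLat f c) q =
      if ((Ideal.span {(q : ℤ)}).primesOver (𝓞 K)).ncard = 2 then 0 else 2 := by
  classical
  haveI := Fact.mk hq
  rw [(ramHyp S h2 b hb f hc hqm).localEmbeddingNumber_eq, if_neg (not_exists_nonmax b hb hq hqc hqd),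
    Brandt.card_filter_add_eq_rho hq.ne_zero, rho_tC_nC_eq_ite b hb h2 hq hqc hqd]
  split_ifs <;> rfl

include h2 hb in
/-- **The local embedding number of `𝒪_c` at a prime `q ∥ N⁺` with `q ∤ N⁻ c d_K`**: `m_q = 1 + (d_K/q)`,
i.e. `2` if `q` splits in `K` and `0` if `q` is inert (Eichler; `N⁺` square-free). [cite: VignerasLNM800, Ch. II §3; Ch. III §5 Thm. 5.11, Exercice 5.2] -/
theorem localEmbeddingNumber_eq_of_dvd_nplus {c : ℕ} (hc : c ≠ 0) (hsqf : Squarefree Nplus) {q : ℕ}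
    (hq : q.Prime) (hqN : q ∣ Nplus) (hqm : ¬ q ∣ Nminus) (hqc : ¬ q ∣ c)
    (hqd : ¬ (q : ℤ) ∣ NumberField.discr K) :
    Brandt.localEmbeddingNumber S.O (gammaC S b f c) (ordLat f c) q =
      if ((Ideal.span {(q : ℤ)}).primesOver (𝓞 K)).ncard = 2 then 2 else 0 := by
  classical
  haveI := Fact.mk hq
  obtain ⟨Φ, H⟩ := exists_levelHyp S h2 b hb f hc hsqf hqN hqm
  rw [H.localEmbeddingNumber_eq, if_neg (not_exists_nonmax b hb hq hqc hqd), add_zero,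
    Brandt.card_filter_add_eq_rho hq.ne_zero, rho_tC_nC_eq_ite b hb h2 hq hqc hqd]

end LocalNumbers

/-! ### §5 Bertolini–Darmon 1996, Lemma 2.5 (1): `#H_N(K; c) = 2^t · h(𝒪_c)` -/

section Main

variable {Nplus Nminus : ℕ} (S : Brandt.XiSetup Nplus Nminus)

/-- Coprimality bookkeeping: a prime factor of `N⁺N⁻` does not divide `d_K` or `c`. [folklore] -/
private theorem not_dvd_of_coprime {N : ℕ} {q : ℕ} (hq : q.Prime) (hqN : q ∣ N) {d : ℤ} (hcop : N.Coprime d.natAbs) :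
    ¬ (q : ℤ) ∣ d := fun h => by
  have h' : q ∣ d.natAbs := Int.natCast_dvd_natCast.mp (Int.dvd_natAbs.mpr h)
  exact hq.one_lt.ne' (Nat.Coprime.eq_one_of_dvd (hcop.of_dvd_left hqN) h')

/-- **Every local embedding number of `𝒪_c` at a prime of `N = N⁺N⁻` equals `2`** under the Heegner
hypothesis (`N` square-free and prime to `c d_K`, primes of `N⁺` split, primes of `N⁻` inert). [cite: VignerasLNM800, Ch. II §3; Ch. III §5 Cor. 5.12] [cite: BertoliniDarmon1996, §2.3 Lemma 2.5 (1)] -/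
theorem localEmbeddingNumber_eq_two (h2 : finrank ℚ K = 2) (b : Basis (Fin 2) ℤ (𝓞 K)) (hb : b 0 = 1)
    (f : K →ₐ[ℚ] S.D) (hsqf : Squarefree (Nplus * Nminus))
    (hcop : (Nplus * Nminus).Coprime (NumberField.discr K).natAbs)
    (hsplit : ∀ ℓ : ℕ, ℓ.Prime → ℓ ∣ Nplus → ((Ideal.span {(ℓ : ℤ)}).primesOver (𝓞 K)).ncard = 2)
    (hinert : ∀ ℓ : ℕ, ℓ.Prime → ℓ ∣ Nminus → ((Ideal.span {(ℓ : ℤ)}).primesOver (𝓞 K)).ncard = 1)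
    {c : ℕ} (hc : c ≠ 0) (hcN : c.Coprime (Nplus * Nminus)) {q : ℕ}
    (hq : q ∈ (Nplus * Nminus).primeFactors) :
    Brandt.localEmbeddingNumber S.O (gammaC S b f c) (ordLat f c) q = 2 := by
  have hqp : q.Prime := Nat.prime_of_mem_primeFactors hq
  have hqN : q ∣ Nplus * Nminus := Nat.dvd_of_mem_primeFactors hq
  have hqd : ¬ (q : ℤ) ∣ NumberField.discr K := not_dvd_of_coprime hqp hqN hcop
  have hqc : ¬ q ∣ c := fun h =>
    hqp.one_lt.ne' (Nat.dvd_one.mp (hcN.gcd_eq_one ▸ Nat.dvd_gcd h hqN))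
  rcases (Nat.Prime.dvd_mul hqp).mp hqN with hqplus | hqminus
  · have hqm : ¬ q ∣ Nminus := fun hqm => hqp.one_lt.ne'
      ((Nat.Coprime.coprime_dvd_left hqplus (Nat.coprime_of_squarefree_mul hsqf)).eq_one_of_dvd hqm)
    rw [localEmbeddingNumber_eq_of_dvd_nplus S h2 b hb f hc hsqf.of_mul_left hqp hqplus hqm hqc hqd,
      if_pos (hsplit q hqp hqplus)]
  · rw [localEmbeddingNumber_eq_of_dvd_nminus S h2 b hb f hc hqp hqminus hqc hqd, if_neg]
    rw [hinert q hqp hqminus]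
    decide

/-- **Bertolini–Darmon 1996, Lemma 2.5 (1), with the class number `h(c² d_K)`.** Let `S` be a Brandt
setup of type `(N⁺, N⁻)` (definite quaternion algebra of discriminant `N⁻`, Eichler order of level
`N⁺`) with `N = N⁺N⁻` square-free and a product of `t` primes, `K` an imaginary quadratic field of
discriminant prime to `N` in which the primes of `N⁺` split and those of `N⁻` are inert, and `c ≥ 1`
prime to `N`. Then the number of Heegner (Gross) points of conductor `c` is
`#H_N(K; c) = 2^t · h(c² d_K)` ("There are exactly `2^t h` Heegner points of conductor `c` on
`X_{N⁺,N⁻}`"; here via Eichler's count `h · ∏_{q ∣ N} m_q` with all `m_q = 2`, the route "cf. [Vi]" of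
the printed proof, instead of the Atkin–Lehner group `W`). [cite: BertoliniDarmon1996, §2.3 Lemma 2.5 (1)] [cite: VignerasLNM800, Ch. III §5 Thm. 5.11, Cor. 5.12] -/
theorem natCard_grossPoints_eq_two_pow_mul_classNumber (hK : IsImaginaryQuadratic K)
    (hsqf : Squarefree (Nplus * Nminus))
    (hcop : (Nplus * Nminus).Coprime (NumberField.discr K).natAbs)
    (hsplit : ∀ ℓ : ℕ, ℓ.Prime → ℓ ∣ Nplus → ((Ideal.span {(ℓ : ℤ)}).primesOver (𝓞 K)).ncard = 2)
    (hinert : ∀ ℓ : ℕ, ℓ.Prime → ℓ ∣ Nminus → ((Ideal.span {(ℓ : ℤ)}).primesOver (𝓞 K)).ncard = 1)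
    {c : ℕ} (hc : c ≠ 0) (hcN : c.Coprime (Nplus * Nminus)) :
    Nat.card (grossPoints K S c) =
      2 ^ (Nplus * Nminus).primeFactors.card * BinQF.classNumber ((c : ℤ) ^ 2 * NumberField.discr K) := by
  have hcopm : ∀ ℓ : ℕ, ℓ.Prime → ℓ ∣ Nminus → ¬ (ℓ : ℤ) ∣ NumberField.discr K := fun ℓ hℓ hℓN =>
    not_dvd_of_coprime hℓ (hℓN.trans (dvd_mul_left Nminus Nplus)) hcop
  obtain ⟨f⟩ := nonempty_algHom S hK hcopm hinert
  obtain ⟨b, hb⟩ := exists_basis_zero_eq_one hK.1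
  rw [natCard_grossPoints_eq_classNumber_mul_prod S hK.1 b hb f hc, classNumber_ordLat_eq S hK.1 b hb f hK hc,
    Finset.prod_congr rfl fun q hq => localEmbeddingNumber_eq_two S hK.1 b hb f hsqf hcop hsplit hinert hc hcN hq,
    Finset.prod_const, mul_comm]

/-- **Bertolini–Darmon 1996, Lemma 2.5 (1): `#H_N(K; c) = 2^t · #Pic(𝒪_c)`** (as printed: "Let `h`
denote the cardinality of `Pic(O)` … There are exactly `2^t h` Heegner points of conductor `c` on
`X_{N⁺,N⁻}`, if `(N⁺, N⁻)` is the factorization satisfying the Heegner condition"), for `K : Type`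
(the universe of the tree's bridge `#Pic(𝒪_c) = h(c² d_K)`, `QuadOrderTower.natCard_classGroup_quadOrder_eq_classNumber`). [cite: BertoliniDarmon1996, §2.3 Lemma 2.5 (1)] [cite: Cox2013, §7.D Thm. 7.24] -/
theorem natCard_grossPoints_eq_two_pow_mul_natCard_classGroup {K : Type} [Field K] [NumberField K]
    (S : Brandt.XiSetup Nplus Nminus) (hK : IsImaginaryQuadratic K)
    (hsqf : Squarefree (Nplus * Nminus))
    (hcop : (Nplus * Nminus).Coprime (NumberField.discr K).natAbs)
    (hsplit : ∀ ℓ : ℕ, ℓ.Prime → ℓ ∣ Nplus → ((Ideal.span {(ℓ : ℤ)}).primesOver (𝓞 K)).ncard = 2)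
    (hinert : ∀ ℓ : ℕ, ℓ.Prime → ℓ ∣ Nminus → ((Ideal.span {(ℓ : ℤ)}).primesOver (𝓞 K)).ncard = 1)
    (c : ℕ) [NeZero c] (hcN : c.Coprime (Nplus * Nminus)) :
    Nat.card (grossPoints K S c) =
      2 ^ (Nplus * Nminus).primeFactors.card * Nat.card (ClassGroup (quadOrder K c)) := by
  have hneg : (c : ℤ) ^ 2 * NumberField.discr K < 0 := by
    have hc0 : (0 : ℤ) < (c : ℤ) ^ 2 := by
      have : (c : ℤ) ≠ 0 := by exact_mod_cast NeZero.ne c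
      positivity
    exact mul_neg_of_pos_of_neg hc0 hK.discr_neg
  rw [natCard_grossPoints_eq_two_pow_mul_classNumber S hK hsqf hcop hsplit hinert (NeZero.ne c) hcN,
    QuadOrderTower.natCard_classGroup_quadOrder_eq_classNumber hK c,
    Literature.NumberTheory.QuadraticFields.BinaryQuadraticForm.binQF_classNumber_eq _ hneg]

/-- **Bertolini–Darmon 1996, Lemma 2.5 (2), for `p ∤ N` and `u = 1`**: with the hypotheses of (1),
a prime `p ∤ N c` and `2 ≤ c ∨ d_K < −4` (so `u = ½ #𝒪_cˣ = 1`), for every `k ≥ 0`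
`#H_N(K; c p^{k+1}) = 2^t · (p − (d_K/p)) p^k · #Pic(𝒪_c)` ("If `n ≥ 1`, then there are exactly
`2^t h u⁻¹ p^{n−1} (p − ε(p))` Heegner points of conductor `cpⁿ`"; here `(N⁺_*, N⁻_*) = (N⁺, N⁻)` as
`p ∤ N`, and `#Pic(𝒪_{cp^{k+1}}) = (p − (d_K/p)) p^k #Pic(𝒪_c)` is the tree's class-number tower; the
Kronecker symbol `(d_K/p)` is spelled as in that file). [cite: BertoliniDarmon1996, §2.3 Lemma 2.5 (2)] [cite: Cox2013, §7.D Thm. 7.24] -/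
theorem natCard_grossPoints_mul_prime_pow {K : Type} [Field K] [NumberField K]
    (S : Brandt.XiSetup Nplus Nminus) (hK : IsImaginaryQuadratic K)
    (hsqf : Squarefree (Nplus * Nminus))
    (hcop : (Nplus * Nminus).Coprime (NumberField.discr K).natAbs)
    (hsplit : ∀ ℓ : ℕ, ℓ.Prime → ℓ ∣ Nplus → ((Ideal.span {(ℓ : ℤ)}).primesOver (𝓞 K)).ncard = 2)
    (hinert : ∀ ℓ : ℕ, ℓ.Prime → ℓ ∣ Nminus → ((Ideal.span {(ℓ : ℤ)}).primesOver (𝓞 K)).ncard = 1)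
    (c : ℕ) [NeZero c] (hcN : c.Coprime (Nplus * Nminus)) {p : ℕ} [hp : Fact p.Prime]
    (hpN : ¬ p ∣ Nplus * Nminus) (hpc : ¬ p ∣ c) (hbase : 2 ≤ c ∨ NumberField.discr K < -4) (k : ℕ) :
    (Nat.card (grossPoints K S (c * p ^ (k + 1))) : ℤ) =
      2 ^ (Nplus * Nminus).primeFactors.card *
        (((p : ℤ) - (if p = 2 then (if NumberField.discr K % 8 = 1 then 1 else if NumberField.discr K % 8 = 5
          then -1 else 0) else jacobiSym (NumberField.discr K) p)) * p ^ k *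
          Nat.card (ClassGroup (quadOrder K c))) := by
  haveI : NeZero (c * p ^ (k + 1)) := ⟨mul_ne_zero (NeZero.ne c) (pow_ne_zero _ hp.out.ne_zero)⟩
  have hcN' : (c * p ^ (k + 1)).Coprime (Nplus * Nminus) :=
    Nat.Coprime.mul_left hcN (Nat.Coprime.pow_left _ ((Nat.Prime.coprime_iff_not_dvd hp.out).mpr hpN))
  rw [natCard_grossPoints_eq_two_pow_mul_natCard_classGroup S hK hsqf hcop hsplit hinert (c * p ^ (k + 1)) hcN',
    Nat.cast_mul, ← QuadOrderTower.natCard_classGroup_eq_of_prime_not_dvd_pow_succ hK hpc hbase k rfl]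
  push_cast
  ring

/-! ### §6 Bertolini–Darmon 1996, Lemma 2.1, the converse direction ("only if") -/

/-- **Bertolini–Darmon 1996, Lemma 2.1 ("only if").** Let `S` be a Brandt setup of type `(M⁺, M⁻)`
with `N = M⁺M⁻` square-free, `K` a quadratic field of discriminant prime to `N`, and `c ≥ 1` prime to
`N`. If `H_{M⁺,M⁻}(K; c)` is non-empty then every prime dividing `M⁺` splits in `K` and every prime
dividing `M⁻` is inert in `K` ("A Heegner point in `H_{M⁺,M⁻}(K; c)` gives rise to an orientation
`O → 𝔽_l` (with `l` dividing `M⁺`) and `O → 𝔽_{l²}` (with `l` dividing `M⁻`). It follows that all `l`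
dividing `M⁺` are split in `K/ℚ`, and that all `l` dividing `M⁻` are inert"; here: a non-zero count
`h · ∏ m_q` forces `m_q ≠ 0`, and `m_q = 1 ± (d_K/q)`). With the existence direction
`GrossPointsExistence.nonempty_grossPoints_of_heegner` this completes Lemma 2.1. [cite: BertoliniDarmon1996, §2.2 Lemma 2.1] [cite: VignerasLNM800, Ch. II §3] -/
theorem split_and_inert_of_nonempty_grossPoints (h2 : finrank ℚ K = 2)
    (hsqf : Squarefree (Nplus * Nminus))
    (hcop : (Nplus * Nminus).Coprime (NumberField.discr K).natAbs)
    {c : ℕ} (hc : c ≠ 0) (hcN : c.Coprime (Nplus * Nminus)) (hne : (grossPoints K S c).Nonempty) :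
    (∀ ℓ : ℕ, ℓ.Prime → ℓ ∣ Nplus → ((Ideal.span {(ℓ : ℤ)}).primesOver (𝓞 K)).ncard = 2) ∧
      (∀ ℓ : ℕ, ℓ.Prime → ℓ ∣ Nminus → ((Ideal.span {(ℓ : ℤ)}).primesOver (𝓞 K)).ncard = 1) := by
  haveI : NeZero c := ⟨hc⟩
  obtain ⟨x, hx⟩ := hne
  obtain ⟨r, rfl, hr⟩ := hx
  set f := r.emb
  obtain ⟨b, hb⟩ := exists_basis_zero_eq_one h2
  have hpos := GrossSpace.natCard_grossPoints_pos S h2 c ⟨_, ⟨r, rfl, hr⟩⟩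
  rw [natCard_grossPoints_eq_classNumber_mul_prod S h2 b hb f hc] at hpos
  have hne0 : ∀ q ∈ (Nplus * Nminus).primeFactors,
      Brandt.localEmbeddingNumber S.O (gammaC S b f c) (ordLat f c) q ≠ 0 := fun q hq h0 => by
    rw [Finset.prod_eq_zero hq h0, mul_zero] at hpos
    exact lt_irrefl 0 hpos
  have hN0 : Nplus * Nminus ≠ 0 := mul_ne_zero S.nplus_ne_zero S.squarefree.ne_zero
  have key : ∀ q : ℕ, q.Prime → q ∣ Nplus * Nminus →
      ¬ (q : ℤ) ∣ NumberField.discr K ∧ ¬ q ∣ c ∧ q ∈ (Nplus * Nminus).primeFactors := fun q hq hqN =>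
    ⟨not_dvd_of_coprime hq hqN hcop,
      fun h => hq.one_lt.ne' (Nat.dvd_one.mp (hcN.gcd_eq_one ▸ Nat.dvd_gcd h hqN)),
      Nat.mem_primeFactors.mpr ⟨hq, hqN, hN0⟩⟩
  refine ⟨fun ℓ hℓ hℓN => ?_, fun ℓ hℓ hℓN => ?_⟩
  · obtain ⟨hqd, hqc, hmem⟩ := key ℓ hℓ (hℓN.trans (dvd_mul_right Nplus Nminus))
    have hℓm : ¬ ℓ ∣ Nminus := fun hm => hℓ.one_lt.ne'
      ((Nat.Coprime.coprime_dvd_left hℓN (Nat.coprime_of_squarefree_mul hsqf)).eq_one_of_dvd hm)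
    have h := hne0 ℓ hmem
    rw [localEmbeddingNumber_eq_of_dvd_nplus S h2 b hb f hc hsqf.of_mul_left hℓ hℓN hℓm hqc hqd] at h
    by_contra hns
    rw [if_neg hns] at h
    exact h rfl
  · obtain ⟨hqd, hqc, hmem⟩ := key ℓ hℓ (hℓN.trans (dvd_mul_left Nminus Nplus))
    have h := hne0 ℓ hmem
    rw [localEmbeddingNumber_eq_of_dvd_nminus S h2 b hb f hc hℓ hℓN hqc hqd] at h
    rw [ncard_primesOver_eq_one_iff_ne_two h2 hℓ]
    intro hs
    rw [if_pos hs] at h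
    exact h rfl

/-- **Bertolini–Darmon 1996, Lemma 2.1, both directions**: for a Brandt setup of type `(M⁺, M⁻)` with
`N = M⁺M⁻` square-free, `K` imaginary quadratic with `(d_K, N) = 1` and `c ≥ 1` prime to `N`,
`H_{M⁺,M⁻}(K; c) ≠ ∅` iff the primes of `M⁺` split and the primes of `M⁻` are inert in `K`
("the set `H_{M⁺,M⁻}(K; c)` is non-empty if and only if `(M⁺, M⁻) = (N⁺, N⁻)`"). [cite: BertoliniDarmon1996, §2.2 Lemma 2.1] -/
theorem nonempty_grossPoints_iff (hK : IsImaginaryQuadratic K) (hsqf : Squarefree (Nplus * Nminus))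
    (hcop : (Nplus * Nminus).Coprime (NumberField.discr K).natAbs)
    {c : ℕ} (hc : c ≠ 0) (hcN : c.Coprime (Nplus * Nminus)) :
    (grossPoints K S c).Nonempty ↔
      (∀ ℓ : ℕ, ℓ.Prime → ℓ ∣ Nplus → ((Ideal.span {(ℓ : ℤ)}).primesOver (𝓞 K)).ncard = 2) ∧
        (∀ ℓ : ℕ, ℓ.Prime → ℓ ∣ Nminus → ((Ideal.span {(ℓ : ℤ)}).primesOver (𝓞 K)).ncard = 1) :=
  ⟨split_and_inert_of_nonempty_grossPoints S hK.1 hsqf hcop hc hcN,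
    fun h => nonempty_grossPoints_of_heegner S hK hsqf hcop h.1 h.2 hc hcN⟩

end Main

/-! ### §7 The `Pic(𝒪_c)`-orbits on `H(c)`: exactly `2^t` of them -/

section Orbits

variable {Nplus Nminus : ℕ}

/-- **The action of `Pic(𝒪_c)` on the set `H_N(K; c)` of Gross points of conductor `c`**, as a
sub-action of the lattice action on the Gross space (BD96 §2.3 (4): "The set `H_N(K; c)` of all
Heegner points of conductor `c` is endowed with a natural action of `Pic(O)`"; stability is the tree's
`GrossSpace.picard_smul_mem_grossPoints`). [cite: BertoliniDarmon1996, §2.3 (4)] -/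
def grossPointsAction (S : Brandt.XiSetup Nplus Nminus) (K : Type u) [Field K] [NumberField K] (c : ℕ)
    [NeZero c] : SubMulAction (ClassGroup (quadOrder K c)) (GrossSpace S.D K) where
  carrier := grossPoints K S c
  smul_mem' := fun σ _ hx => picard_smul_mem_grossPoints hx σ

/-- The carrier of the action is `H(c)` (definitional). [cite: BertoliniDarmon1996, §2.3 (4)] -/
theorem mem_grossPointsAction_iff (S : Brandt.XiSetup Nplus Nminus) {c : ℕ} [NeZero c]
    {x : GrossSpace S.D K} : x ∈ grossPointsAction S K c ↔ x ∈ grossPoints K S c := Iff.rfl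

/-- **`#H(c) = #(orbits) · #Pic(𝒪_c)`**: `H(c)` is the disjoint union of its `Pic(𝒪_c)`-orbits, each a
copy of `Pic(𝒪_c)` (free action, tree `GrossSpace.picard_smul_left_injective`). [cite: BertoliniDarmon1996, §2.3 (after (4)) and Lemma 2.5 (1)] -/
theorem natCard_grossPoints_eq_natCard_quotient_mul (S : Brandt.XiSetup Nplus Nminus)
    (h2 : finrank ℚ K = 2) (c : ℕ) [NeZero c] :
    Nat.card (grossPoints K S c) =
      Nat.card (MulAction.orbitRel.Quotient (ClassGroup (quadOrder K c)) (grossPointsAction S K c)) *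
        Nat.card (ClassGroup (quadOrder K c)) := by
  classical
  set T := grossPointsAction S K c
  have horb : ∀ x : T, Nonempty (MulAction.orbit (ClassGroup (quadOrder K c)) x ≃
      ClassGroup (quadOrder K c)) := fun x =>
    ⟨(Equiv.ofBijective
      (fun g : ClassGroup (quadOrder K c) =>
        (⟨g • x, MulAction.mem_orbit x g⟩ : MulAction.orbit (ClassGroup (quadOrder K c)) x))
      ⟨fun g g' hgg' => GrossSpace.picard_smul_left_injective S h2 x.2 (by
          have h := congrArg
            (fun y : MulAction.orbit (ClassGroup (quadOrder K c)) x => ((y : T) : GrossSpace S.D K)) hgg'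
          simpa [SubMulAction.val_smul] using h),
       fun y => by
          obtain ⟨g, hg⟩ := MulAction.mem_orbit_iff.mp y.2
          exact ⟨g, Subtype.ext hg⟩⟩).symm⟩
  let e : T ≃ MulAction.orbitRel.Quotient (ClassGroup (quadOrder K c)) T × ClassGroup (quadOrder K c) :=
    (MulAction.selfEquivSigmaOrbits (ClassGroup (quadOrder K c)) T).trans
      ((Equiv.sigmaCongrRight fun ω : MulAction.orbitRel.Quotient (ClassGroup (quadOrder K c)) T =>
          (horb ω.out).some).trans
        (Equiv.sigmaEquivProd _ _))
  have hT : Nat.card (grossPoints K S c) = Nat.card T := rfl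
  rw [hT, Nat.card_congr e, Nat.card_prod]

/-- **There are exactly `2^t` orbits of `Pic(𝒪_c)` on `H_N(K; c)`** (BD96 Lemma 2.5, proof: "the group
`Pic(O) × W` acts simply transitively on the set `H_N(K; c)` … the orbits of Heegner points under the
action of `Pic(O)` correspond exactly to sets of Heegner points with a given orientation", `#W = 2^t`):
from `#H(c) = 2^t · #Pic(𝒪_c)` (§5) and `#H(c) = #(orbits) · #Pic(𝒪_c)` with `#Pic(𝒪_c) ≠ 0`
(`K : Type`). [cite: BertoliniDarmon1996, §2.3 Lemma 2.5 (1) (proof)] -/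
theorem natCard_orbits_grossPoints_eq_two_pow {K : Type} [Field K] [NumberField K]
    (S : Brandt.XiSetup Nplus Nminus) (hK : IsImaginaryQuadratic K)
    (hsqf : Squarefree (Nplus * Nminus))
    (hcop : (Nplus * Nminus).Coprime (NumberField.discr K).natAbs)
    (hsplit : ∀ ℓ : ℕ, ℓ.Prime → ℓ ∣ Nplus → ((Ideal.span {(ℓ : ℤ)}).primesOver (𝓞 K)).ncard = 2)
    (hinert : ∀ ℓ : ℕ, ℓ.Prime → ℓ ∣ Nminus → ((Ideal.span {(ℓ : ℤ)}).primesOver (𝓞 K)).ncard = 1)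
    (c : ℕ) [NeZero c] (hcN : c.Coprime (Nplus * Nminus)) :
    Nat.card (MulAction.orbitRel.Quotient (ClassGroup (quadOrder K c)) (grossPointsAction S K c)) =
      2 ^ (Nplus * Nminus).primeFactors.card := by
  have h := natCard_grossPoints_eq_natCard_quotient_mul S hK.1 c
  rw [natCard_grossPoints_eq_two_pow_mul_natCard_classGroup S hK hsqf hcop hsplit hinert c hcN] at h
  haveI : Finite (ClassGroup (quadOrder K c)) := QuadOrderTower.finite_classGroup c
  have hpos : 0 < Nat.card (ClassGroup (quadOrder K c)) := Nat.card_pos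
  exact (Nat.eq_of_mul_eq_mul_right hpos h).symm

end Orbits

/-! ### §8 Conductor `1`: `#H_N(K; 1) = 2^t h_K` -/

section ConductorOne

variable {Nplus Nminus : ℕ} (S : Brandt.XiSetup Nplus Nminus)

/-- **Bertolini–Darmon 1996, Lemma 2.5 (1) at conductor `1`: `#H_N(K; 1) = 2^t · h_K`.** For `K`
imaginary quadratic with `d_K` prime to the square-free `N = N⁺N⁻`, every `ℓ ∣ N⁺` split and every
`ℓ ∣ N⁻` inert in `K`, the Gross points of conductor `1` (optimal embeddings of the maximal order
`𝒪_K`) number `2^t` times the class number `h_K` of `K` (`#Pic(𝒪_K) = h_K`; here through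
`h(d_K) = h_K`, the tree's `Quadratic.card_reducedForms_eq_classNumber`). [cite: BertoliniDarmon1996, §2.3 Lemma 2.5 (1)] -/
theorem natCard_grossPoints_one_eq_two_pow_mul_classNumber (hK : IsImaginaryQuadratic K)
    (hsqf : Squarefree (Nplus * Nminus))
    (hcop : (Nplus * Nminus).Coprime (NumberField.discr K).natAbs)
    (hsplit : ∀ ℓ : ℕ, ℓ.Prime → ℓ ∣ Nplus → ((Ideal.span {(ℓ : ℤ)}).primesOver (𝓞 K)).ncard = 2)
    (hinert : ∀ ℓ : ℕ, ℓ.Prime → ℓ ∣ Nminus → ((Ideal.span {(ℓ : ℤ)}).primesOver (𝓞 K)).ncard = 1) :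
    Nat.card (grossPoints K S 1) = 2 ^ (Nplus * Nminus).primeFactors.card * NumberField.classNumber K := by
  rw [natCard_grossPoints_eq_two_pow_mul_classNumber S hK hsqf hcop hsplit hinert one_ne_zero
    (Nat.coprime_one_left _), Nat.cast_one, one_pow, one_mul,
    Literature.NumberTheory.QuadraticFields.BinaryQuadraticForm.binQF_classNumber_eq _ hK.discr_neg,
    card_reducedForms_eq_classNumber hK.1 hK.discr_neg]

end ConductorOne

/-! ### §9 Lemma 2.5 (2) at `c = 1` for every `K`: the unit index `u` -/

section UnitIndex

variable {Nplus Nminus : ℕ}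

/-- **Bertolini–Darmon 1996, Lemma 2.5 (2) at `c = 1`, with the unit index `u = ½ #𝒪_Kˣ`** ("If
`n ≥ 1`, then there are exactly `2^t h u⁻¹ p^{n−1} (p − ε(p))` Heegner points of conductor `cpⁿ`",
`u = ½ #𝒪ˣ`, "`u = 1` unless `c = 1` and `K = ℚ(i)` or `ℚ(√−3)`"): for `K` imaginary quadratic with the
hypotheses of Lemma 2.5 (1), a prime `p ∤ N` and `n ≥ 1`,
`#H_N(K; pⁿ) · #𝒪_Kˣ = 2^t · 2 h_K · p^{n−1} · (p − (d_K/p))` (the Kronecker symbol spelled as in the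
tree's class-number formula; `(N⁺_*, N⁻_*) = (N⁺, N⁻)` as `p ∤ N`; `p ∣ d_K` is allowed, `(d_K/p) = 0`).
From §5 `#H = 2^t · #Pic(𝒪_{pⁿ})` and Cox's Theorem 7.24 `#Pic(𝒪_f) · #𝒪_Kˣ = 2 h_K ∏ p^{k−1}(p − (d_K/p))`
(tree `RingClass.card_ringClassGroup_mul_card_units_of_two_le`, `QuadOrderTower.natCard_classGroup_quadOrder_eq`). [cite: BertoliniDarmon1996, §2.3 Lemma 2.5 (2)] [cite: Cox2013, §7.D Thm. 7.24] -/
theorem natCard_grossPoints_prime_pow_mul_card_units {K : Type} [Field K] [NumberField K]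
    (S : Brandt.XiSetup Nplus Nminus) (hK : IsImaginaryQuadratic K)
    (hsqf : Squarefree (Nplus * Nminus))
    (hcop : (Nplus * Nminus).Coprime (NumberField.discr K).natAbs)
    (hsplit : ∀ ℓ : ℕ, ℓ.Prime → ℓ ∣ Nplus → ((Ideal.span {(ℓ : ℤ)}).primesOver (𝓞 K)).ncard = 2)
    (hinert : ∀ ℓ : ℕ, ℓ.Prime → ℓ ∣ Nminus → ((Ideal.span {(ℓ : ℤ)}).primesOver (𝓞 K)).ncard = 1)
    {p : ℕ} [hp : Fact p.Prime] (hpN : ¬ p ∣ Nplus * Nminus) {n : ℕ} (hn : n ≠ 0) :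
    (Nat.card (grossPoints K S (p ^ n)) : ℤ) * Nat.card (𝓞 K)ˣ =
      2 ^ (Nplus * Nminus).primeFactors.card * (2 * NumberField.classNumber K *
        ((p : ℤ) ^ (n - 1) * ((p : ℤ) - (if p = 2 then (if NumberField.discr K % 8 = 1 then 1
          else if NumberField.discr K % 8 = 5 then -1 else 0) else jacobiSym (NumberField.discr K) p)))) := by
  haveI : NeZero (p ^ n) := ⟨pow_ne_zero _ hp.out.ne_zero⟩
  have hcN : (p ^ n).Coprime (Nplus * Nminus) :=
    Nat.Coprime.pow_left _ ((Nat.Prime.coprime_iff_not_dvd hp.out).mpr hpN)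
  have h2le : 2 ≤ p ^ n := le_trans hp.out.two_le (Nat.le_self_pow hn p)
  rw [natCard_grossPoints_eq_two_pow_mul_natCard_classGroup S hK hsqf hcop hsplit hinert (p ^ n) hcN,
    Nat.cast_mul, mul_assoc, QuadOrderTower.natCard_classGroup_quadOrder_eq hK (p ^ n),
    Literature.NumberTheory.QuadraticFields.RingClass.card_ringClassGroup_mul_card_units_of_two_le hK.1
      hK.discr_neg h2le, Nat.primeFactors_prime_pow hn hp.out, Finset.prod_singleton, hp.out.factorization_pow,
    Finsupp.single_eq_same]
  push_cast
  ring

end UnitIndex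

/-! ### §10 Lemma 2.5 (2) at a prime `p ∣ N`: conductor divisible by a prime of the level -/

/-! Bertolini–Darmon 1996, Lemma 2.2 and Lemma 2.5 (2) for a prime `p` DIVIDING `N`: the Heegner
points of conductor `c pⁿ` (`n ≥ 1`, `(c, N d_K) = 1`, `p ∤ c d_K`) live on the curve of the
factorisation `(N⁺_*, N⁻_*)`, which is `(N⁺, N⁻)` if `p ∣ N⁺` and `(N⁺ p, N⁻/p)` if `p ∣ N⁻` — in both
cases `p ∥ N⁺_*` — and number `2^t h u⁻¹ p^{n−1} (p − ε(p))`. In Eichler's count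
`#H = h(𝒪) · ∏_{q ∣ N} m_q(𝒪)` (§3) the local embedding number at a prime `q ∥ N⁺` dividing the
conductor is `m_q = ρ_q + [𝒪_q not maximal] = 1 + 1 = 2` whatever the behaviour of `q` in `K`
(Eichler's symbol `{𝒪/q} = 1` for `q ∣ f(𝒪)`; tree `Brandt.LevelHyp.localEmbeddingNumber_eq`), so the
count `2^t · h(𝒪)` of §5 persists when the primes of `N⁺` dividing the conductor are exempted from the
splitting hypothesis. -/

section LevelConductor

variable {Nplus Nminus : ℕ}
variable (b : Basis (Fin 2) ℤ (𝓞 K)) (hb : b 0 = 1)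

omit [NumberField K] in
/-- **`ρ_q(t_c, n_c) = 1` for a prime `q ∣ c`**: `t_c = c t ≡ 0` and `n_c = −c² m ≡ 0 (mod q)`, so
`k² + t_c k + n_c ≡ k²` has the single root `k ≡ 0 (mod q)`. [cite: Cox2013, §7.D Prop. 7.20] -/
theorem rho_tC_nC_eq_one_of_dvd {q : ℕ} (hq : q.Prime) {c : ℕ} (hqc : q ∣ c) :
    Brandt.rho q (tC b c) (nC b c) = 1 := by
  classical
  rw [← Brandt.card_filter_add_eq_rho hq.ne_zero]
  have hqZ : Prime (q : ℤ) := Nat.prime_iff_prime_int.mp hq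
  have hqc' : (q : ℤ) ∣ (c : ℤ) := Int.natCast_dvd_natCast.mpr hqc
  have ht : (q : ℤ) ∣ tC b c := by rw [tC]; exact hqc'.mul_right _
  have hn : (q : ℤ) ∣ nC b c := by rw [nC]; exact dvd_neg.mpr ((dvd_pow hqc' two_ne_zero).mul_right _)
  have key : ∀ k : ℕ, ((q : ℤ) ∣ (k : ℤ) ^ 2 + tC b c * k + nC b c) ↔ q ∣ k := by
    intro k
    have e : (k : ℤ) ^ 2 + tC b c * k + nC b c = (k : ℤ) ^ 2 + (tC b c * k + nC b c) := by ring
    rw [e, dvd_add_left (dvd_add (ht.mul_right _) hn)]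
    exact ⟨fun h => Int.natCast_dvd_natCast.mp (hqZ.dvd_of_dvd_pow h),
      fun h => dvd_pow (Int.natCast_dvd_natCast.mpr h) two_ne_zero⟩
  have hS : (Finset.range q).filter (fun k : ℕ => (q : ℤ) ∣ (k : ℤ) ^ 2 + tC b c * k + nC b c) = {0} := by
    ext k
    simp only [Finset.mem_filter, Finset.mem_range, Finset.mem_singleton, key]
    exact ⟨fun h => Nat.eq_zero_of_dvd_of_lt h.2 h.1, fun h => h ▸ ⟨hq.pos, dvd_zero q⟩⟩
  rw [hS, Finset.card_singleton]

omit [NumberField K] in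
/-- **`𝒪_c` is not maximal at a prime `q ∣ c`**: `k = 0` has `q ∣ t_c + 2k` and `q² ∣ k² + t_c k + n_c`
(`t_c = c t`, `n_c = −c² m`). [cite: Cox2013, §7.A Lemma 7.2, §7.D Prop. 7.20] -/
theorem exists_nonmax_of_dvd {q : ℕ} {c : ℕ} (hqc : q ∣ c) :
    ∃ k : ℤ, (q : ℤ) ∣ tC b c + 2 * k ∧ (q : ℤ) ^ 2 ∣ k ^ 2 + tC b c * k + nC b c := by
  have hqc' : (q : ℤ) ∣ (c : ℤ) := Int.natCast_dvd_natCast.mpr hqc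
  refine ⟨0, ?_, ?_⟩
  · rw [mul_zero, add_zero, tC]
    exact hqc'.mul_right _
  · have h : (q : ℤ) ^ 2 ∣ nC b c := by
      rw [nC]; exact dvd_neg.mpr ((pow_dvd_pow_of_dvd hqc' 2).mul_right _)
    simpa using h

variable (S : Brandt.XiSetup Nplus Nminus) (h2 : finrank ℚ K = 2) (f : K →ₐ[ℚ] S.D)

include h2 hb in
/-- **The local embedding number of `𝒪_c` at a prime `q ∥ N⁺` dividing the conductor is `2`**:
`m_q = ρ_q(t_c, n_c) + [𝒪_c not maximal at q] = 1 + 1` (Eichler order of level `q`, `N⁺` square-free;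
Eichler's table: `m_q = 2` for `q ∣ f(𝒪)`, whatever the splitting of `q` in `K`). [cite: VignerasLNM800, Ch. II §3; Ch. III §5 Thm. 5.11, Exercice 5.2] -/
theorem localEmbeddingNumber_eq_two_of_dvd_nplus_of_dvd {c : ℕ} (hc : c ≠ 0) (hsqf : Squarefree Nplus)
    {q : ℕ} (hq : q.Prime) (hqN : q ∣ Nplus) (hqm : ¬ q ∣ Nminus) (hqc : q ∣ c) :
    Brandt.localEmbeddingNumber S.O (gammaC S b f c) (ordLat f c) q = 2 := by
  classical
  haveI := Fact.mk hq
  obtain ⟨Φ, H⟩ := exists_levelHyp S h2 b hb f hc hsqf hqN hqm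
  rw [H.localEmbeddingNumber_eq, if_pos (exists_nonmax_of_dvd b hqc), Brandt.card_filter_add_eq_rho hq.ne_zero,
    rho_tC_nC_eq_one_of_dvd b hq hqc]

include h2 hb in
/-- **Every local embedding number of `𝒪_c` at a prime of `N = N⁺N⁻` equals `2`** when `N` is square-free
and prime to `d_K`, `c` is prime to `N⁻`, every prime of `N⁻` is inert and every prime of `N⁺` either
divides `c` or splits in `K` (the primes of `N⁺` dividing `c` need no splitting hypothesis). [cite: VignerasLNM800, Ch. II §3; Ch. III §5 Cor. 5.12] [cite: BertoliniDarmon1996, §2.3 Lemma 2.5 (2)] -/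
theorem localEmbeddingNumber_eq_two_of_coprime_nminus (hsqf : Squarefree (Nplus * Nminus))
    (hcop : (Nplus * Nminus).Coprime (NumberField.discr K).natAbs)
    {c : ℕ} (hc : c ≠ 0) (hcN : c.Coprime Nminus)
    (hsplit : ∀ ℓ : ℕ, ℓ.Prime → ℓ ∣ Nplus → ¬ ℓ ∣ c → ((Ideal.span {(ℓ : ℤ)}).primesOver (𝓞 K)).ncard = 2)
    (hinert : ∀ ℓ : ℕ, ℓ.Prime → ℓ ∣ Nminus → ((Ideal.span {(ℓ : ℤ)}).primesOver (𝓞 K)).ncard = 1)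
    {q : ℕ} (hq : q ∈ (Nplus * Nminus).primeFactors) :
    Brandt.localEmbeddingNumber S.O (gammaC S b f c) (ordLat f c) q = 2 := by
  have hqp : q.Prime := Nat.prime_of_mem_primeFactors hq
  have hqN : q ∣ Nplus * Nminus := Nat.dvd_of_mem_primeFactors hq
  have hqd : ¬ (q : ℤ) ∣ NumberField.discr K := not_dvd_of_coprime hqp hqN hcop
  rcases (Nat.Prime.dvd_mul hqp).mp hqN with hqplus | hqminus
  · have hqm : ¬ q ∣ Nminus := fun hqm => hqp.one_lt.ne'
      ((Nat.Coprime.coprime_dvd_left hqplus (Nat.coprime_of_squarefree_mul hsqf)).eq_one_of_dvd hqm)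
    by_cases hqc : q ∣ c
    · exact localEmbeddingNumber_eq_two_of_dvd_nplus_of_dvd b hb S h2 f hc hsqf.of_mul_left hqp hqplus hqm hqc
    · rw [localEmbeddingNumber_eq_of_dvd_nplus S h2 b hb f hc hsqf.of_mul_left hqp hqplus hqm hqc hqd,
        if_pos (hsplit q hqp hqplus hqc)]
  · have hqc : ¬ q ∣ c := fun h =>
      hqp.one_lt.ne' (Nat.dvd_one.mp (hcN.gcd_eq_one ▸ Nat.dvd_gcd h hqminus))
    rw [localEmbeddingNumber_eq_of_dvd_nminus S h2 b hb f hc hqp hqminus hqc hqd, if_neg]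
    rw [hinert q hqp hqminus]
    decide

/-- **`#H_N(K; c) = 2^t · h(c² d_K)` with the primes of `N⁺` dividing `c` exempted from the splitting
hypothesis** (Bertolini–Darmon 1996, Lemma 2.5 (1) and (2) at once): `S` a Brandt setup of type
`(N⁺, N⁻)` with `N = N⁺N⁻` square-free, a product of `t` primes and prime to `d_K`; `K` imaginary
quadratic; every prime of `N⁻` inert in `K`; `c ≥ 1` prime to `N⁻`; every prime of `N⁺` not dividing `c`
split in `K`. Lemma 2.5 (2) for `p ∣ N` is the case `c = c₀ pⁿ`, `p ∥ N⁺ = N⁺_*`. [cite: BertoliniDarmon1996, §2.2 Lemma 2.2, §2.3 Lemma 2.5 (2)] [cite: VignerasLNM800, Ch. III §5 Thm. 5.11, Cor. 5.12] -/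
theorem natCard_grossPoints_eq_two_pow_mul_classNumber_of_coprime_nminus (hK : IsImaginaryQuadratic K)
    (hsqf : Squarefree (Nplus * Nminus))
    (hcop : (Nplus * Nminus).Coprime (NumberField.discr K).natAbs)
    {c : ℕ} (hc : c ≠ 0) (hcN : c.Coprime Nminus)
    (hsplit : ∀ ℓ : ℕ, ℓ.Prime → ℓ ∣ Nplus → ¬ ℓ ∣ c → ((Ideal.span {(ℓ : ℤ)}).primesOver (𝓞 K)).ncard = 2)
    (hinert : ∀ ℓ : ℕ, ℓ.Prime → ℓ ∣ Nminus → ((Ideal.span {(ℓ : ℤ)}).primesOver (𝓞 K)).ncard = 1) :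
    Nat.card (grossPoints K S c) =
      2 ^ (Nplus * Nminus).primeFactors.card * BinQF.classNumber ((c : ℤ) ^ 2 * NumberField.discr K) := by
  have hcopm : ∀ ℓ : ℕ, ℓ.Prime → ℓ ∣ Nminus → ¬ (ℓ : ℤ) ∣ NumberField.discr K := fun ℓ hℓ hℓN =>
    not_dvd_of_coprime hℓ (hℓN.trans (dvd_mul_left Nminus Nplus)) hcop
  obtain ⟨f⟩ := nonempty_algHom S hK hcopm hinert
  obtain ⟨b, hb⟩ := exists_basis_zero_eq_one hK.1
  rw [natCard_grossPoints_eq_classNumber_mul_prod S hK.1 b hb f hc, classNumber_ordLat_eq S hK.1 b hb f hK hc,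
    Finset.prod_congr rfl fun q hq =>
      localEmbeddingNumber_eq_two_of_coprime_nminus b hb S hK.1 f hsqf hcop hc hcN hsplit hinert hq,
    Finset.prod_const, mul_comm]

/-- **`#H_N(K; c) = 2^t · #Pic(𝒪_c)` with the primes of `N⁺` dividing `c` exempted from the splitting
hypothesis** (`K : Type`, through the tree's `#Pic(𝒪_c) = h(c² d_K)`). [cite: BertoliniDarmon1996, §2.3 Lemma 2.5 (1)–(2)] [cite: Cox2013, §7.D Thm. 7.24] -/
theorem natCard_grossPoints_eq_two_pow_mul_natCard_classGroup_of_coprime_nminus {K : Type} [Field K]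
    [NumberField K] (S : Brandt.XiSetup Nplus Nminus) (hK : IsImaginaryQuadratic K)
    (hsqf : Squarefree (Nplus * Nminus))
    (hcop : (Nplus * Nminus).Coprime (NumberField.discr K).natAbs)
    (c : ℕ) [NeZero c] (hcN : c.Coprime Nminus)
    (hsplit : ∀ ℓ : ℕ, ℓ.Prime → ℓ ∣ Nplus → ¬ ℓ ∣ c → ((Ideal.span {(ℓ : ℤ)}).primesOver (𝓞 K)).ncard = 2)
    (hinert : ∀ ℓ : ℕ, ℓ.Prime → ℓ ∣ Nminus → ((Ideal.span {(ℓ : ℤ)}).primesOver (𝓞 K)).ncard = 1) :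
    Nat.card (grossPoints K S c) =
      2 ^ (Nplus * Nminus).primeFactors.card * Nat.card (ClassGroup (quadOrder K c)) := by
  have hneg : (c : ℤ) ^ 2 * NumberField.discr K < 0 := by
    have hc0 : (0 : ℤ) < (c : ℤ) ^ 2 := by
      have : (c : ℤ) ≠ 0 := by exact_mod_cast NeZero.ne c
      positivity
    exact mul_neg_of_pos_of_neg hc0 hK.discr_neg
  rw [natCard_grossPoints_eq_two_pow_mul_classNumber_of_coprime_nminus S hK hsqf hcop (NeZero.ne c) hcN hsplit
    hinert, QuadOrderTower.natCard_classGroup_quadOrder_eq_classNumber hK c,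
    Literature.NumberTheory.QuadraticFields.BinaryQuadraticForm.binQF_classNumber_eq _ hneg]

/-- **Bertolini–Darmon 1996, Lemma 2.5 (2), for `p ∣ N⁺` (and `u = 1`).** `S` a Brandt setup of type
`(N⁺, N⁻)` with `N = N⁺N⁻` square-free, a product of `t` primes, prime to `d_K`; `K` imaginary quadratic
with every prime of `N⁻` inert and every prime of `N⁺` other than `p` split; `p ∣ N⁺`; `c ≥ 1` prime to
`N` with `2 ≤ c ∨ d_K < −4` (so `u = ½ #𝒪_cˣ = 1`). Then for every `k ≥ 0`
`#H_N(K; c p^{k+1}) = 2^t · (p − (d_K/p)) p^k · #Pic(𝒪_c)` ("If `n ≥ 1`, then there are exactly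
`2^t h u⁻¹ p^{n−1} (p − ε(p))` Heegner points of conductor `cpⁿ` on `X_{N⁺_*,N⁻_*}`"; the printed case
`p ∣ N⁻`, `(N⁺_*, N⁻_*) = (N⁺p, N⁻/p)`, is this statement for the setup of type `(N⁺p, N⁻/p)`, in which `p`
is inert — no splitting hypothesis is made at `p`; the Kronecker symbol is spelled as in the tree's
class-number tower). [cite: BertoliniDarmon1996, §2.2 Lemma 2.2, §2.3 Lemma 2.5 (2)] [cite: Cox2013, §7.D Thm. 7.24] -/
theorem natCard_grossPoints_mul_prime_pow_of_dvd_nplus {K : Type} [Field K] [NumberField K]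
    (S : Brandt.XiSetup Nplus Nminus) (hK : IsImaginaryQuadratic K)
    (hsqf : Squarefree (Nplus * Nminus))
    (hcop : (Nplus * Nminus).Coprime (NumberField.discr K).natAbs)
    {p : ℕ} [hp : Fact p.Prime] (hpN : p ∣ Nplus)
    (hsplit : ∀ ℓ : ℕ, ℓ.Prime → ℓ ∣ Nplus → ℓ ≠ p → ((Ideal.span {(ℓ : ℤ)}).primesOver (𝓞 K)).ncard = 2)
    (hinert : ∀ ℓ : ℕ, ℓ.Prime → ℓ ∣ Nminus → ((Ideal.span {(ℓ : ℤ)}).primesOver (𝓞 K)).ncard = 1)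
    (c : ℕ) [NeZero c] (hcN : c.Coprime (Nplus * Nminus)) (hbase : 2 ≤ c ∨ NumberField.discr K < -4)
    (k : ℕ) :
    (Nat.card (grossPoints K S (c * p ^ (k + 1))) : ℤ) =
      2 ^ (Nplus * Nminus).primeFactors.card *
        (((p : ℤ) - (if p = 2 then (if NumberField.discr K % 8 = 1 then 1 else if NumberField.discr K % 8 = 5
          then -1 else 0) else jacobiSym (NumberField.discr K) p)) * p ^ k *
          Nat.card (ClassGroup (quadOrder K c))) := by
  haveI : NeZero (c * p ^ (k + 1)) := ⟨mul_ne_zero (NeZero.ne c) (pow_ne_zero _ hp.out.ne_zero)⟩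
  have hpm : ¬ p ∣ Nminus := fun hpm => hp.out.one_lt.ne'
    ((Nat.Coprime.coprime_dvd_left hpN (Nat.coprime_of_squarefree_mul hsqf)).eq_one_of_dvd hpm)
  have hpc : ¬ p ∣ c := fun h =>
    hp.out.one_lt.ne' (Nat.dvd_one.mp (hcN.gcd_eq_one ▸ Nat.dvd_gcd h (hpN.trans (dvd_mul_right Nplus Nminus))))
  have hcN' : (c * p ^ (k + 1)).Coprime Nminus :=
    Nat.Coprime.mul_left (hcN.coprime_dvd_right (dvd_mul_left Nminus Nplus))
      (Nat.Coprime.pow_left _ ((Nat.Prime.coprime_iff_not_dvd hp.out).mpr hpm))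
  have hsplit' : ∀ ℓ : ℕ, ℓ.Prime → ℓ ∣ Nplus → ¬ ℓ ∣ c * p ^ (k + 1) →
      ((Ideal.span {(ℓ : ℤ)}).primesOver (𝓞 K)).ncard = 2 := fun ℓ hℓ hℓN hℓc =>
    hsplit ℓ hℓ hℓN fun h => hℓc (h ▸ dvd_mul_of_dvd_right (dvd_pow_self p (Nat.succ_ne_zero k)) c)
  rw [natCard_grossPoints_eq_two_pow_mul_natCard_classGroup_of_coprime_nminus S hK hsqf hcop (c * p ^ (k + 1))
    hcN' hsplit' hinert, Nat.cast_mul, ← QuadOrderTower.natCard_classGroup_eq_of_prime_not_dvd_pow_succ hK hpc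
    hbase k rfl]
  push_cast
  ring

/-- **Bertolini–Darmon 1996, Lemma 2.5 (2), for `p ∣ N⁺` at `c = 1`, with the unit index
`u = ½ #𝒪_Kˣ`**: with the hypotheses of the previous theorem (every prime of `N⁺` other than `p`
split, every prime of `N⁻` inert, `N` square-free and prime to `d_K`) and `n ≥ 1`,
`#H_N(K; pⁿ) · #𝒪_Kˣ = 2^t · 2 h_K · p^{n−1} · (p − (d_K/p))`. [cite: BertoliniDarmon1996, §2.3 Lemma 2.5 (2)] [cite: Cox2013, §7.D Thm. 7.24] -/
theorem natCard_grossPoints_prime_pow_mul_card_units_of_dvd_nplus {K : Type} [Field K] [NumberField K]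
    (S : Brandt.XiSetup Nplus Nminus) (hK : IsImaginaryQuadratic K)
    (hsqf : Squarefree (Nplus * Nminus))
    (hcop : (Nplus * Nminus).Coprime (NumberField.discr K).natAbs)
    {p : ℕ} [hp : Fact p.Prime] (hpN : p ∣ Nplus)
    (hsplit : ∀ ℓ : ℕ, ℓ.Prime → ℓ ∣ Nplus → ℓ ≠ p → ((Ideal.span {(ℓ : ℤ)}).primesOver (𝓞 K)).ncard = 2)
    (hinert : ∀ ℓ : ℕ, ℓ.Prime → ℓ ∣ Nminus → ((Ideal.span {(ℓ : ℤ)}).primesOver (𝓞 K)).ncard = 1)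
    {n : ℕ} (hn : n ≠ 0) :
    (Nat.card (grossPoints K S (p ^ n)) : ℤ) * Nat.card (𝓞 K)ˣ =
      2 ^ (Nplus * Nminus).primeFactors.card * (2 * NumberField.classNumber K *
        ((p : ℤ) ^ (n - 1) * ((p : ℤ) - (if p = 2 then (if NumberField.discr K % 8 = 1 then 1
          else if NumberField.discr K % 8 = 5 then -1 else 0) else jacobiSym (NumberField.discr K) p)))) := by
  haveI : NeZero (p ^ n) := ⟨pow_ne_zero _ hp.out.ne_zero⟩
  have hpm : ¬ p ∣ Nminus := fun hpm => hp.out.one_lt.ne'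
    ((Nat.Coprime.coprime_dvd_left hpN (Nat.coprime_of_squarefree_mul hsqf)).eq_one_of_dvd hpm)
  have hcN : (p ^ n).Coprime Nminus :=
    Nat.Coprime.pow_left _ ((Nat.Prime.coprime_iff_not_dvd hp.out).mpr hpm)
  have hsplit' : ∀ ℓ : ℕ, ℓ.Prime → ℓ ∣ Nplus → ¬ ℓ ∣ p ^ n →
      ((Ideal.span {(ℓ : ℤ)}).primesOver (𝓞 K)).ncard = 2 := fun ℓ hℓ hℓN hℓc =>
    hsplit ℓ hℓ hℓN fun h => hℓc (h ▸ dvd_pow_self p hn)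
  have h2le : 2 ≤ p ^ n := le_trans hp.out.two_le (Nat.le_self_pow hn p)
  rw [natCard_grossPoints_eq_two_pow_mul_natCard_classGroup_of_coprime_nminus S hK hsqf hcop (p ^ n) hcN hsplit'
    hinert, Nat.cast_mul, mul_assoc, QuadOrderTower.natCard_classGroup_quadOrder_eq hK (p ^ n),
    Literature.NumberTheory.QuadraticFields.RingClass.card_ringClassGroup_mul_card_units_of_two_le hK.1
      hK.discr_neg h2le, Nat.primeFactors_prime_pow hn hp.out, Finset.prod_singleton, hp.out.factorization_pow,
    Finsupp.single_eq_same]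
  push_cast
  ring

end LevelConductor

end GrossPointsCount

end Literature.NumberTheory.EllipticCurves

end
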